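import Literature.Probability.RandomPlanarGeometry.YangBaxterSAWGrouping
import Literature.Probability.RandomPlanarGeometry.YangBaxterSAWExcursionLocal
import HarnessLib

/-!
# Glazman–Manolescu, Lemma 2.1: the winding of an excursion (and Corollary 2.3 assembled)

Topic `Literature/Probability/RandomPlanarGeometry`; seventh support file for the discharge of
`Literature.Probability.RandomPlanarGeometry.SAW.YangBaxter.GlazmanManolescu2019_thm1`. It
DISCHARGES the named fact `GlazmanManolescu2019_excursionWinding` of `YangBaxterSAWGrouping.lean`
(`GlazmanManolescu2019_excursionWinding_holds`) — the planar-topology input of the grouping argument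
of Lemma 2.1 (A. Glazman, I. Manolescu, arXiv:1708.00395; proof = [Gl], A. Glazman, ECP 20 (2015),
Lemma 3.1): the excursion of a self-avoiding walk of `Rect_{T,L}` outside a rhombus `r`, from its
exit side `z₁` to its return side `z₂` after the first crossing of `∂r` at `z₀`, winds by the
tabulated `excursionWinding θ_r z₀ z₁ z₂` — and assembles the consequences now available in the
tree: **Lemma 2.1** (`GlazmanManolescu2019_lem21_holds`), **Lemma 2.2**
(`GlazmanManolescu2019_lem22_holds`) and **Corollary 2.3** (`GlazmanManolescu2019_cor23_holds`,
`cos(3π/8) A_{T,Θ} + B_{T,Θ} = 1`), whence Theorems 1 and 2 from Propositions 1.1 and 4.2 only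
(`GlazmanManolescu2019_thm1_of_prop11_prop42`, `GlazmanManolescu2019_thm2_of_prop11_prop42`).

## The argument (a two-base-point form of Hopf's Umlaufsatz; no Jordan curve theorem is needed)

Let `ω` be a walk of class `B2a` (`YangBaxterSAWGrouping.lean`): prefix `P` from the origin to the
first crossing of `∂r` at the midpoint `m₀` of the side `z₀`, one arc `z₀ → z₁` inside `r`, then
the excursion `X` outside `r` back to the side `z₂`, where it stops.
1. **Reductions.** By the potential/telescoping identity of `YangBaxterSAWBoundaryWinding.lean`
   applied to the suffix walk (`YBWalk.drop`), the winding of the excursion at the angles `Θ` is its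
   right-angle winding plus `(θ_r − π/2)(𝟙[z₂ slanted] − 𝟙[z₁ slanted])`
   (`Ω.WE_eq_WE_pi_div_two_add`), matching the table (`excursionWinding_theta`); by the reversal
   involution `Ω.rev` (which negates the excursion winding) it suffices to treat the twelve
   `Canon`ical orientations (`canon_or_swap`, `excursionWinding_swap`).
2. **Hopf's identity for an open lattice polyline** (`Ω.hopfQ`, from `Hopf.hopf_open` of
   `HexSAWHopf.lean`): the path `Q = m₀ → c₀ → c₁ → (inner points of X) → q_last → E → tail → w`
   in the integer drawing of mesh `4` (`Ω.Qp`: the walk polyline of `YangBaxterSAWBoundaryWinding`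
   from its first arc in `r` on, then one or two points of corner type inside `r`, `tailOffs`)
   satisfies Hopf's hypothesis (`Ω.subtQ`: the walk part by `YBWalk.subtended`, the rest by decided
   tables for the near faces — `table_tailSeg_inner`, `table_corner_chord`, `table_local` — and a
   norm bound for the far ones, `sdot_pos_split`). Its total turning is
   `arcTurn(π/2) z₀ z₁ + W_{π/2}(X) + (tail terms)` (`Ω.T_eq`, `Ω.sum_extQ_walk_eq`) and equals the
   angle `S₂` swept by the secant from `m₀` plus the angle `S₁` swept by the secant into `w`.
3. **The closed polygon `J`** = inner points of `X` closed through `r` by the chord `c₂ → c₁`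
   (`Ω.pJ`) and its winding angle `A_J(b)` (`Ω.AJ`, `sweep`): the excursion parts of `S₂` and `S₁`
   are those of `A_J(m₀)` and `A_J(w)` (`Ω.S₂_eq`, `Ω.S₁_eq`); the remaining local terms depend
   only on `(z₀, z₁, z₂)` (`Ω.WE_pi_div_two_eq_Loc`, `Loc`).
4. **`A_J(m₀) = A_J(w) = 0`**: `A_J` vanishes at the starting midpoint of the walk (`J` lies in
   `{x ≥ 1}`, `Ω.AJ_origin`), is transported unchanged along the midpoints of the prefix
   (`Ω.AJ_prefix_step`: every plaquette of the secant homotopy is valid — `plaquette`,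
   `sweep_eq_sweep_of_closed`; the segments of `J` from those midpoints and the rungs of the prefix
   from the vertices of `J` are acute by `sdot_midPt_pos`, `one_lt_dist_midPt` and the decided
   `table_rung_inner`, whose same-face exceptions are excluded by side-disjointness and `noncross`,
   `YBWalk.not_straight_of_two_arcs`), and from `m₀` to `w` by one more rung (`table_rung_w`).
5. **Exact evaluation** of the local terms (`Loc_eq` of `YangBaxterSAWExcursionLocal.lean`, the
   companion file holding the walk-independent data, tables and angle algebra).
-/

noncomputable section

open Complex Real

namespace Literature.Probability.RandomPlanarGeometry.SAW.YangBaxter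

/-! ### The local points of an excursion -/

/-- Points of corner type (both coordinates odd) differ from midpoints and inner points, and are
at squared distance `≥ 2` from every midpoint. [folklore] -/
theorem cornerType_ne_midPt {p : ℤ × ℤ} (hp : p.1 % 2 = 1 ∧ p.2 % 2 = 1) (e : MidEdge) : p ≠ midPt e := by
  intro h; subst h; cases e <;> simp [midPt] at hp <;> omega

/-- A point of corner type is not an inner point. [folklore] -/
theorem cornerType_ne_innerPt {p : ℤ × ℤ} (hp : p.1 % 2 = 1 ∧ p.2 % 2 = 1) (g : Face) (σ : Side) : p ≠ innerPt g σ := by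
  intro h; subst h
  obtain ⟨k, j⟩ := g
  cases σ <;> simp [innerPt, Face.base, Side.inOff, Side.offset, Side.nIn] at hp <;> omega

/-- A point of corner type is at squared distance `≥ 2` from every midpoint. [folklore] -/
theorem two_le_dist_cornerType_midPt {p : ℤ × ℤ} (hp : p.1 % 2 = 1 ∧ p.2 % 2 = 1) (e : MidEdge) :
    2 ≤ ((midPt e).1 - p.1) ^ 2 + ((midPt e).2 - p.2) ^ 2 := by
  have hsq : ∀ x : ℤ, x % 2 = 1 ∨ x % 2 = -1 → 1 ≤ x ^ 2 := by
    intro x hx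
    have hx0 : x ≠ 0 := by rintro rfl; simp at hx
    nlinarith [Int.one_le_abs hx0, sq_abs x, abs_nonneg x]
  have h1 : 1 ≤ ((midPt e).1 - p.1) ^ 2 := by
    apply hsq; cases e <;> simp [midPt] <;> omega
  have h2 : 1 ≤ ((midPt e).2 - p.2) ^ 2 := by
    apply hsq; cases e <;> simp [midPt] <;> omega
  omega

/-- Corner offsets give points of corner type. [folklore] -/
theorem base_add_cornerType (f : Face) {u : ℤ × ℤ} (hu : (u.1 = 1 ∨ u.1 = 3) ∧ (u.2 = 1 ∨ u.2 = 3)) :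
    (f.base + u).1 % 2 = 1 ∧ (f.base + u).2 % 2 = 1 := by
  obtain ⟨k, j⟩ := f
  simp only [Face.base, Prod.fst_add, Prod.snd_add]
  omega

namespace Ω

section Excursion

variable {T L : ℕ} {r : Face} (ω : Ω T L r)

/-- In class `B2a` the excursion has at least two arcs. [folklore] -/
theorem three_le (hr : r ∈ rect T L) (h : ω.IsB2a) : ω.2.firstHit + 3 ≤ ω.2.arcs.length := by
  have := ω.2.firstHit_add_three_le_returnHit hr h.1; rw [h.2] at this; exact this

/-- The first arc in `r`: its face and sides in the polyline bookkeeping. [folklore] -/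
theorem fc_fh (hr : r ∈ rect T L) (h : ω.IsB2a) : ω.2.fc ω.2.firstHit = r ∧ ω.2.sIn ω.2.firstHit = ω.2.firstSide ∧
    ω.2.sOut ω.2.firstHit = ω.2.exitSide hr (ω.fh_lt h) := by
  have hfh := ω.fh_lt h
  have hface := (YBWalk.arcFace_arcAt hfh).1
  rw [YBWalk.arcAt_eq hfh] at hface
  have hface' : arcFace (ω.2.mids[ω.2.firstHit]'(by have := ω.2.length_arcs; omega),
      ω.2.mids[ω.2.firstHit + 1]'(YBWalk.lt_length_of_lt_arcs hfh)) = some r := by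
    rw [← ω.2.nth_eq_getElem, ← ω.2.nth_eq_getElem, ω.2.nth_firstHit, (ω.2.exitSide_spec hr hfh).1]
    exact arcFace_side_side r _ _ (ω.2.exitSide_spec hr hfh).2.symm
  rw [hface'] at hface
  have hfc : ω.2.fc ω.2.firstHit = r := (Option.some_injective _ hface).symm
  obtain ⟨hs, ht, -⟩ := YBWalk.side_sIn hfh
  rw [hfc, ← ω.2.nth_eq_getElem, ω.2.nth_firstHit] at hs
  rw [hfc, ← ω.2.nth_eq_getElem, (ω.2.exitSide_spec hr hfh).1] at ht
  exact ⟨hfc, r.side_injective hs, r.side_injective ht⟩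

/-- The entry inner point of the first arc in `r` is `c₀`. [folklore] -/
theorem vtx_c₀ (hr : r ∈ rect T L) (h : ω.IsB2a) : ω.2.vtx (2 * ω.2.firstHit + 1) = innerPt r ω.2.firstSide := by
  rw [YBWalk.vtx_odd (ω.fh_lt h), YBWalk.ptIn, (ω.fc_fh hr h).1, (ω.fc_fh hr h).2.1]

/-- The exit inner point of the first arc in `r` is `c₁`. [folklore] -/
theorem vtx_c₁ (hr : r ∈ rect T L) (h : ω.IsB2a) : ω.2.vtx (2 * ω.2.firstHit + 2) = innerPt r (ω.2.exitSide hr (ω.fh_lt h)) := by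
  rw [YBWalk.vtx_even (ω.fh_lt h), YBWalk.ptOut, (ω.fc_fh hr h).1, (ω.fc_fh hr h).2.2]

/-- The last vertex of the walk polyline is the midpoint of the return side. [folklore] -/
theorem vtx_E : ω.2.vtx (2 * ω.2.arcs.length + 1) = midPt (r.side ω.1) := YBWalk.vtx_last

/-- The faces of the excursion arcs are not `r`. [folklore] -/
theorem fc_ne (hr : r ∈ rect T L) (h : ω.IsB2a) {i : ℕ} (h1 : ω.2.firstHit < i) (h2 : i < ω.2.arcs.length) : ω.2.fc i ≠ r := by
  intro e
  have hface := (YBWalk.arcFace_arcAt h2).1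
  rw [YBWalk.arcAt_eq h2, e, ← ω.2.nth_eq_getElem, ← ω.2.nth_eq_getElem] at hface
  exact ω.arcFace_ne_of_isB2a hr h h2 (by omega) hface

/-- The last vertex before the return: one unit outside the return side. [folklore] -/
theorem vtx_qlast (hr : r ∈ rect T L) (h : ω.IsB2a) : ω.2.vtx (2 * ω.2.arcs.length) = midPt (r.side ω.1) - (ω.1).nIn := by
  have hn : 0 < ω.2.arcs.length := by have := ω.three_le hr h; omega
  have hlt : ω.2.arcs.length - 1 < ω.2.arcs.length := by omega
  have hside : (ω.2.fc (ω.2.arcs.length - 1)).side (ω.2.sOut (ω.2.arcs.length - 1)) = r.side ω.1 :=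
    YBWalk.side_sOut_last hn
  have hne : ω.2.fc (ω.2.arcs.length - 1) ≠ r := ω.fc_ne hr h (by have := ω.three_le hr h; omega) hlt
  have eν := nIn_eq_neg_of_side_eq hside hne
  rw [show 2 * ω.2.arcs.length = 2 * (ω.2.arcs.length - 1) + 2 by omega, YBWalk.vtx_even hlt, YBWalk.ptOut, innerPt_eq, hside]
  rw [show (ω.2.sOut (ω.2.arcs.length - 1)).nIn = -(ω.1).nIn from by rw [eν, neg_neg], ← sub_eq_add_neg]

/-- Midpoints of sides as base plus offset. [folklore] -/
theorem midPt_side_eq (s : Side) : midPt (r.side s) = r.base + s.offset := midPt_side r s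

end Excursion

end Ω

namespace Ω

section Path

variable {T L : ℕ} {r : Face} (ω : Ω T L r) (hr : r ∈ rect T L)

/-- The exit side. [folklore] -/
def z1 (h : ω.IsB2a) : Side := ω.2.exitSide hr (ω.fh_lt h)

/-- The number of arcs from the first crossing on. [folklore] -/
def Mv : ℕ := ω.2.arcs.length - ω.2.firstHit

/-- The tail points. [folklore] -/
def tailPt (h : ω.IsB2a) (i : ℕ) : ℤ × ℤ := r.base + (tailOffs ω.2.firstSide (ω.z1 hr h) ω.1).getD i (0, 0)

/-- The length of the tail. [folklore] -/
def τ (h : ω.IsB2a) : ℕ := (tailOffs ω.2.firstSide (ω.z1 hr h) ω.1).length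

/-- **The open path of the excursion**: the midpoint of the first side, the polyline of the walk
from its first arc in `r` to the midpoint of the return side, then the tail inside `r`. [folklore] -/
def Qp (h : ω.IsB2a) (j : ℕ) : ℤ × ℤ :=
  if j = 0 then midPt (r.side ω.2.firstSide)
  else if j ≤ 2 * ω.Mv + 1 then ω.2.vtx (2 * ω.2.firstHit + j)
  else ω.tailPt hr h (j - (2 * ω.Mv + 2))

variable {ω hr}

/-- The tail is nonempty. [folklore] -/
theorem τ_pos (h : ω.IsB2a) : 0 < ω.τ hr h := tailOffs_length_pos _ _ _
/-- The tail has at most two points. [folklore] -/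
theorem τ_le (h : ω.IsB2a) : ω.τ hr h ≤ 2 := tailOffs_length_le _ _ _
/-- At least three arcs from the first crossing on. [folklore] -/
theorem three_le_Mv (hr : r ∈ rect T L) (h : ω.IsB2a) : 3 ≤ ω.Mv := by have := ω.three_le hr h; unfold Mv; omega
/-- The arcs split at the first crossing. [folklore] -/
theorem fh_add_Mv (h : ω.IsB2a) : ω.2.firstHit + ω.Mv = ω.2.arcs.length := by
  have := ω.fh_lt h; unfold Mv; omega

/-- The open path starts at `m₀`. [folklore] -/
theorem Qp_zero (h : ω.IsB2a) : ω.Qp hr h 0 = r.base + ω.2.firstSide.offset := by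
  rw [Qp, if_pos rfl, midPt_side]

/-- The walk part of the open path. [folklore] -/
theorem Qp_mid (h : ω.IsB2a) {j : ℕ} (h1 : 1 ≤ j) (h2 : j ≤ 2 * ω.Mv + 1) :
    ω.Qp hr h j = ω.2.vtx (2 * ω.2.firstHit + j) := by
  rw [Qp, if_neg (by omega), if_pos h2]

/-- The second vertex of the open path is `c₀`. [folklore] -/
theorem Qp_one (h : ω.IsB2a) : ω.Qp hr h 1 = r.base + ω.2.firstSide.inOff := by
  rw [Qp_mid h le_rfl (by omega), ω.vtx_c₀ hr h, innerPt]

/-- The third vertex of the open path is `c₁`. [folklore] -/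
theorem Qp_two (h : ω.IsB2a) : ω.Qp hr h 2 = r.base + (ω.z1 hr h).inOff := by
  rw [Qp_mid h (by omega) (by have := three_le_Mv hr h; omega), ω.vtx_c₁ hr h, innerPt, z1]

/-- The walk part of the open path ends at the midpoint of the return side. [folklore] -/
theorem Qp_E (h : ω.IsB2a) : ω.Qp hr h (2 * ω.Mv + 1) = r.base + (ω.1).offset := by
  rw [Qp_mid h (by omega) le_rfl, show 2 * ω.2.firstHit + (2 * ω.Mv + 1) = 2 * ω.2.arcs.length + 1 by
    have := fh_add_Mv h; omega, ω.vtx_E, midPt_side]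

/-- The vertex before the return midpoint: one unit outside the return side. [folklore] -/
theorem Qp_qlast (h : ω.IsB2a) : ω.Qp hr h (2 * ω.Mv) = r.base + ((ω.1).offset - (ω.1).nIn) := by
  rw [Qp_mid h (by have := three_le_Mv hr h; omega) (by omega),
    show 2 * ω.2.firstHit + 2 * ω.Mv = 2 * ω.2.arcs.length by have := fh_add_Mv h; omega,
    ω.vtx_qlast hr h, midPt_side, add_sub_assoc]

/-- The tail part of the open path. [folklore] -/
theorem Qp_tail (h : ω.IsB2a) {i : ℕ} : ω.Qp hr h (2 * ω.Mv + 2 + i) = ω.tailPt hr h i := by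
  rw [Qp, if_neg (by omega), if_neg (by omega)]; congr 1; omega

/-- Tail points are of corner type. [folklore] -/
theorem tailPt_cornerType (h : ω.IsB2a) {i : ℕ} (hi : i < ω.τ hr h) :
    (ω.tailPt hr h i).1 % 2 = 1 ∧ (ω.tailPt hr h i).2 % 2 = 1 := by
  apply base_add_cornerType
  apply tailOffs_mem
  rw [List.getD_eq_getElem?_getD, List.getElem?_eq_getElem hi, Option.getD_some]
  exact List.getElem_mem _

/-- Tail offsets are tail offsets. [folklore] -/
theorem tailPt_off_mem (h : ω.IsB2a) {i : ℕ} (hi : i < ω.τ hr h) :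
    (tailOffs ω.2.firstSide (ω.z1 hr h) ω.1).getD i (0, 0) ∈ tailOffs ω.2.firstSide (ω.z1 hr h) ω.1 := by
  rw [List.getD_eq_getElem?_getD, List.getElem?_eq_getElem hi, Option.getD_some]
  exact List.getElem_mem _

/-- Interior vertices of the walk part are inner points of faces of the walk. [folklore] -/
theorem vtx_eq_innerPt {j : ℕ} (h1 : 1 ≤ j) (h2 : j ≤ 2 * ω.2.arcs.length) :
    ∃ i, i < ω.2.arcs.length ∧ (2 * i + 1 = j ∨ 2 * i + 2 = j) ∧ ∃ σ : Side,
      ω.2.vtx j = innerPt (ω.2.fc i) σ ∧ (ω.2.fc i).side σ ∈ [ω.2.nth i, ω.2.nth (i + 1)] := by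
  rcases YBWalk.index_cases (γ := ω.2) j (by omega) with h0 | ⟨i, hi, rfl⟩ | ⟨i, hi, rfl⟩ | h0
  · omega
  · refine ⟨i, hi, Or.inl rfl, ω.2.sIn i, YBWalk.vtx_odd hi, ?_⟩
    rw [(YBWalk.side_sIn hi).1, ← ω.2.nth_eq_getElem]; simp
  · refine ⟨i, hi, Or.inr rfl, ω.2.sOut i, YBWalk.vtx_even hi, ?_⟩
    rw [(YBWalk.side_sIn hi).2.1, ← ω.2.nth_eq_getElem]; simp
  · omega

/-! #### Hopf's hypothesis for the open path -/

/-- A walk of class `B2a` has an arc. [folklore] -/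
theorem n_pos (hr : r ∈ rect T L) (h : ω.IsB2a) : 0 < ω.2.arcs.length := by have := ω.three_le hr h; omega

/-- Consecutive tail vertices of the open path form a tail segment. [folklore] -/
theorem tailSeg_mem (h : ω.IsB2a) {i : ℕ} (hi : i < ω.τ hr h) :
    ∃ sg ∈ tailSegs ω.2.firstSide (ω.z1 hr h) ω.1,
      ω.Qp hr h (2 * ω.Mv + 1 + i) = r.base + sg.1 ∧ ω.Qp hr h (2 * ω.Mv + 2 + i) = r.base + sg.2 := by
  have hτ := τ_le (ω := ω) (hr := hr) h
  unfold τ at hi hτ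
  refine ⟨((ω.1.offset :: tailOffs ω.2.firstSide (ω.z1 hr h) ω.1)[i]'(by simp; omega),
    (tailOffs ω.2.firstSide (ω.z1 hr h) ω.1)[i]'hi), ?_, ?_, ?_⟩
  · unfold tailSegs
    rw [List.mem_iff_getElem]
    exact ⟨i, by simp [List.length_zip]; omega, by simp [List.getElem_zip]⟩
  · rcases Nat.eq_zero_or_pos i with rfl | hpos
    · simp only [add_zero, List.getElem_cons_zero]; exact Qp_E h
    · obtain ⟨i', rfl⟩ : ∃ i', i = i' + 1 := ⟨i - 1, by omega⟩
      rw [show 2 * ω.Mv + 1 + (i' + 1) = 2 * ω.Mv + 2 + i' by ring, Qp_tail h, tailPt,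
        List.getD_eq_getElem?_getD, List.getElem?_eq_getElem (by omega), Option.getD_some]
      simp
  · rw [Qp_tail h, tailPt, List.getD_eq_getElem?_getD, List.getElem?_eq_getElem hi, Option.getD_some]

/-- Segment `0`: the first half-segment, from the other vertices. [folklore] -/
theorem subt_k0 (h : ω.IsB2a) {j : ℕ} (hj2 : 2 ≤ j) (hj : j ≤ 2 * ω.Mv + ω.τ hr h + 1) :
    0 < sdot (ω.Qp hr h 0) (ω.Qp hr h 1) (ω.Qp hr h j) := by
  have hM := three_le_Mv hr h
  have hfM := fh_add_Mv (ω := ω) h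
  have e1 : ω.Qp hr h 1 = ω.Qp hr h 0 + ω.2.firstSide.nIn := by
    rw [Qp_one h, Qp_zero h, Side.inOff, add_assoc]
  rw [e1]
  refine sdot_half_pos _ ?_ ?_
  · -- `Qp j ≠ m₀`
    rw [Qp_zero h, ← midPt_side]
    by_cases hjm : j ≤ 2 * ω.Mv + 1
    · rw [Qp_mid h (by omega) hjm]
      rcases hjm.lt_or_eq with hjm | rfl
      · obtain ⟨i, hi, -, σ, e, -⟩ := vtx_eq_innerPt (ω := ω) (j := 2 * ω.2.firstHit + j) (by omega) (by omega)
        rw [e]; exact (midPt_ne_innerPt _ _ _).symm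
      · rw [show 2 * ω.2.firstHit + (2 * ω.Mv + 1) = 2 * ω.2.arcs.length + 1 by omega, ω.vtx_E]
        intro hh
        have := r.side_injective (midPt_injective hh)
        exact (ω.firstSide_ne_fst h) this.symm
    · obtain ⟨i, rfl⟩ : ∃ i, j = 2 * ω.Mv + 2 + i := ⟨j - (2 * ω.Mv + 2), by omega⟩
      rw [Qp_tail h]
      exact cornerType_ne_midPt (tailPt_cornerType h (by omega)) _
  · -- `Qp j ≠ c₀`
    rw [← e1]
    by_cases hjm : j ≤ 2 * ω.Mv + 1
    · rw [Qp_mid h (by omega) hjm, Qp_mid h le_rfl (by omega)]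
      intro hh
      have := YBWalk.vtx_injective (γ := ω.2) (by omega) (by omega) (n_pos hr h) hh
      omega
    · obtain ⟨i, rfl⟩ : ∃ i, j = 2 * ω.Mv + 2 + i := ⟨j - (2 * ω.Mv + 2), by omega⟩
      rw [Qp_tail h, Qp_one h, ← innerPt]
      exact cornerType_ne_innerPt (tailPt_cornerType h (by omega)) _ _

/-- Segments of the walk part, from `m₀`. [folklore] -/
theorem subt_kmid_j0 (h : ω.IsB2a) {k : ℕ} (hk1 : 1 ≤ k) (hk2 : k ≤ 2 * ω.Mv) :
    0 < sdot (ω.Qp hr h k) (ω.Qp hr h (k + 1)) (ω.Qp hr h 0) := by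
  have hM := three_le_Mv hr h
  have hfM := fh_add_Mv (ω := ω) h
  rw [Qp_mid h hk1 (by omega), Qp_mid h (by omega) (by omega), Qp_zero h, ← midPt_side,
    show 2 * ω.2.firstHit + (k + 1) = 2 * ω.2.firstHit + k + 1 by ring]
  -- the segment `[vtx K, vtx (K+1)]`, `K = 2 fh + k`
  rcases Nat.even_or_odd k with ⟨t, ht⟩ | ⟨t, ht⟩
  · -- `K` even: crossing segment or the final half-segment; `K = 2 i + 2` with `i = fh + t - 1`
    have ht1 : 1 ≤ t := by omega
    set i := ω.2.firstHit + t - 1 with hi_def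
    have hK : 2 * ω.2.firstHit + k = 2 * i + 2 := by omega
    have hi : i < ω.2.arcs.length := by omega
    rw [hK]
    rcases Nat.lt_or_ge (i + 1) ω.2.arcs.length with hi1 | hi1
    · -- crossing at `mids[i+1]`
      have eν : (ω.2.sIn (i + 1)).nIn = -(ω.2.sOut i).nIn :=
        nIn_eq_neg_of_side_eq (((YBWalk.side_sIn hi).2.1).trans ((YBWalk.side_sIn hi1).1).symm) (YBWalk.fc_succ_ne hi1)
      have ek : ω.2.vtx (2 * i + 2) = midPt (ω.2.mids[i + 1]'(YBWalk.lt_length_of_lt_arcs hi)) - (ω.2.sIn (i + 1)).nIn := by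
        rw [YBWalk.vtx_even hi, YBWalk.ptOut, innerPt_eq, (YBWalk.side_sIn hi).2.1, eν, sub_neg_eq_add]
      have ek1 : ω.2.vtx (2 * i + 2 + 1) = midPt (ω.2.mids[i + 1]'(YBWalk.lt_length_of_lt_arcs hi)) + (ω.2.sIn (i + 1)).nIn := by
        rw [show 2 * i + 2 + 1 = 2 * (i + 1) + 1 by ring, YBWalk.vtx_odd hi1, YBWalk.ptIn, innerPt_eq, (YBWalk.side_sIn hi1).1]
      rw [ek, ek1, sdot_cross_eq, Side.nIn_sq]
      have hne : ω.2.mids[i + 1]'(YBWalk.lt_length_of_lt_arcs hi) ≠ r.side ω.2.firstSide := by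
        rw [← ω.2.nth_eq_getElem, ← ω.2.nth_firstHit]
        intro hh; have := ω.2.nth_inj (by omega) (by omega) hh; omega
      have := one_lt_dist_midPt hne
      simp only [Prod.fst_sub, Prod.snd_sub] at this
      omega
    · -- final half-segment `[q_last, E]`
      have hi' : i + 1 = ω.2.arcs.length := by omega
      have e2 : 2 * i + 2 = 2 * ω.2.arcs.length := by omega
      rw [e2, ω.vtx_qlast hr h, ω.vtx_E]
      rw [show sdot (midPt (r.side ω.1) - ω.1.nIn) (midPt (r.side ω.1)) = sdot (midPt (r.side ω.1) - ω.1.nIn)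
          (midPt (r.side ω.1) - ω.1.nIn + ω.1.nIn) from by rw [sub_add_cancel]]
      refine sdot_half_pos _ ?_ ?_
      · rw [← ω.vtx_qlast hr h]
        obtain ⟨i', -, -, σ, e, -⟩ := vtx_eq_innerPt (ω := ω) (j := 2 * ω.2.arcs.length) (by omega) le_rfl
        rw [e]; exact midPt_ne_innerPt _ _ _
      · rw [sub_add_cancel]
        intro hh
        exact ω.firstSide_ne_fst h (r.side_injective (midPt_injective hh))
  · -- `K` odd: chord of the face `fc i`, `i = fh + t`
    set i := ω.2.firstHit + t with hi_def
    have hK : 2 * ω.2.firstHit + k = 2 * i + 1 := by omega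
    have hi : i < ω.2.arcs.length := by omega
    rw [hK, YBWalk.vtx_odd hi, show 2 * i + 1 + 1 = 2 * i + 2 by ring, YBWalk.vtx_even hi, YBWalk.ptIn, YBWalk.ptOut]
    exact sdot_midPt_pos _ (YBWalk.side_sIn hi).2.2 _

/-- Segments of the walk part, from vertices of the walk part. [folklore] -/
theorem subt_kmid_jmid (h : ω.IsB2a) {k j : ℕ} (hk1 : 1 ≤ k) (hk2 : k ≤ 2 * ω.Mv) (hj1 : 1 ≤ j) (hj2 : j ≤ 2 * ω.Mv + 1)
    (h1 : j ≠ k) (h2 : j ≠ k + 1) : 0 < sdot (ω.Qp hr h k) (ω.Qp hr h (k + 1)) (ω.Qp hr h j) := by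
  have hfM := fh_add_Mv (ω := ω) h
  rw [Qp_mid h hk1 (by omega), Qp_mid h (by omega) (by omega), Qp_mid h hj1 hj2,
    show 2 * ω.2.firstHit + (k + 1) = 2 * ω.2.firstHit + k + 1 by ring]
  exact YBWalk.subtended (by omega) (by omega) (by omega) (by omega) (n_pos hr h)

/-- Segments of the walk part, from the tail points. [folklore] -/
theorem subt_kmid_jtail (h : ω.IsB2a) (hc : Canon ω.2.firstSide (ω.z1 hr h) ω.1) {k : ℕ} (hk1 : 1 ≤ k)
    (hk2 : k ≤ 2 * ω.Mv) {i' : ℕ} (hi' : i' < ω.τ hr h) :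
    0 < sdot (ω.Qp hr h k) (ω.Qp hr h (k + 1)) (ω.tailPt hr h i') := by
  have hM := three_le_Mv hr h
  have hfM := fh_add_Mv (ω := ω) h
  have hct := tailPt_cornerType (ω := ω) (hr := hr) h hi'
  rw [Qp_mid h hk1 (by omega), Qp_mid h (by omega) (by omega),
    show 2 * ω.2.firstHit + (k + 1) = 2 * ω.2.firstHit + k + 1 by ring]
  rcases Nat.even_or_odd k with ⟨t, ht⟩ | ⟨t, ht⟩
  · have ht1 : 1 ≤ t := by omega
    set i := ω.2.firstHit + t - 1 with hi_def
    have hK : 2 * ω.2.firstHit + k = 2 * i + 2 := by omega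
    have hi : i < ω.2.arcs.length := by omega
    rw [hK]
    rcases Nat.lt_or_ge (i + 1) ω.2.arcs.length with hi1 | hi1
    · have eν : (ω.2.sIn (i + 1)).nIn = -(ω.2.sOut i).nIn :=
        nIn_eq_neg_of_side_eq (((YBWalk.side_sIn hi).2.1).trans ((YBWalk.side_sIn hi1).1).symm) (YBWalk.fc_succ_ne hi1)
      have ek : ω.2.vtx (2 * i + 2) = midPt (ω.2.mids[i + 1]'(YBWalk.lt_length_of_lt_arcs hi)) - (ω.2.sIn (i + 1)).nIn := by
        rw [YBWalk.vtx_even hi, YBWalk.ptOut, innerPt_eq, (YBWalk.side_sIn hi).2.1, eν, sub_neg_eq_add]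
      have ek1 : ω.2.vtx (2 * i + 2 + 1) = midPt (ω.2.mids[i + 1]'(YBWalk.lt_length_of_lt_arcs hi)) + (ω.2.sIn (i + 1)).nIn := by
        rw [show 2 * i + 2 + 1 = 2 * (i + 1) + 1 by ring, YBWalk.vtx_odd hi1, YBWalk.ptIn, innerPt_eq, (YBWalk.side_sIn hi1).1]
      rw [ek, ek1, sdot_cross_eq, Side.nIn_sq]
      have := two_le_dist_cornerType_midPt hct (ω.2.mids[i + 1]'(YBWalk.lt_length_of_lt_arcs hi))
      omega
    · have e2 : 2 * i + 2 = 2 * ω.2.arcs.length := by omega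
      rw [e2, ω.vtx_qlast hr h, ω.vtx_E]
      rw [show sdot (midPt (r.side ω.1) - ω.1.nIn) (midPt (r.side ω.1)) = sdot (midPt (r.side ω.1) - ω.1.nIn)
          (midPt (r.side ω.1) - ω.1.nIn + ω.1.nIn) from by rw [sub_add_cancel]]
      refine sdot_half_pos _ ?_ ?_
      · rw [← ω.vtx_qlast hr h]
        obtain ⟨i'', -, -, σ, e, -⟩ := vtx_eq_innerPt (ω := ω) (j := 2 * ω.2.arcs.length) (by omega) le_rfl
        rw [e]; exact cornerType_ne_innerPt hct _ _
      · rw [sub_add_cancel]; exact cornerType_ne_midPt hct _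
  · set i := ω.2.firstHit + t with hi_def
    have hK : 2 * ω.2.firstHit + k = 2 * i + 1 := by omega
    have hi : i < ω.2.arcs.length := by omega
    rw [hK, YBWalk.vtx_odd hi, show 2 * i + 1 + 1 = 2 * i + 2 by ring, YBWalk.vtx_even hi, YBWalk.ptIn, YBWalk.ptOut]
    have hoff := tailPt_off_mem (ω := ω) (hr := hr) h hi'
    rcases Nat.eq_zero_or_pos t with rfl | htpos
    · -- the chord `[c₀, c₁]` of `r`
      have hi0 : i = ω.2.firstHit := by omega
      simp only [hi0, (ω.fc_fh hr h).1, (ω.fc_fh hr h).2.1, (ω.fc_fh hr h).2.2]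
      rw [tailPt, innerPt, innerPt, add_comm r.base, add_comm r.base, add_comm r.base, sdot_add]
      exact ((table_local _ _ _ hc).2.2.1 i' (by have := τ_le (ω := ω) (hr := hr) h; omega) hi').2
    · -- a chord of a face of the excursion, `≠ r`
      have hne : ω.2.fc i ≠ r := ω.fc_ne hr h (by omega) hi
      rw [tailPt, innerPt, innerPt]
      have hmem := tailOffs_mem _ _ _ _ hoff
      refine sdot_pos_split' r (ω.2.fc i) (ω.2.sIn i).inOff_mem (ω.2.sOut i).inOff_mem (by omega) ?_
      intro d hd hg
      have hd0 : d ≠ (0, 0) := by rintro rfl; apply hne; rw [hg]; simp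
      refine table_corner_chord _ ?_ d hd hd0 _ _ (YBWalk.side_sIn hi).2.2
      generalize (tailOffs ω.snd.firstSide (ω.z1 hr h) ω.fst).getD i' (0, 0) = p at hmem ⊢
      obtain ⟨u, v⟩ := p
      simp only at hmem
      rcases hmem with ⟨rfl | rfl, rfl | rfl⟩ <;> simp

/-- The number of tail points from the return midpoint on. [folklore] -/
theorem tailPts_length (h : ω.IsB2a) : (tailPts ω.2.firstSide (ω.z1 hr h) ω.1).length = ω.τ hr h + 1 := by
  simp [tailPts, τ]

/-- The tail vertices of the open path from the return midpoint on. [folklore] -/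
theorem Qp_tailPts (h : ω.IsB2a) {i : ℕ} (hi : i ≤ ω.τ hr h) :
    ω.Qp hr h (2 * ω.Mv + 1 + i) = r.base + (tailPts ω.2.firstSide (ω.z1 hr h) ω.1).getD i (0, 0) := by
  rcases Nat.eq_zero_or_pos i with rfl | hpos
  · rw [add_zero, Qp_E h]; simp [tailPts]
  · obtain ⟨i', rfl⟩ : ∃ i', i = i' + 1 := ⟨i - 1, by omega⟩
    rw [show 2 * ω.Mv + 1 + (i' + 1) = 2 * ω.Mv + 2 + i' by ring, Qp_tail h, tailPt]
    simp only [tailPts, List.getD_cons_succ]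

/-- The tail segments, from the other vertices. [folklore] -/
theorem subt_ktail (h : ω.IsB2a) (hc : Canon ω.2.firstSide (ω.z1 hr h) ω.1) {i' : ℕ} (hi' : i' < ω.τ hr h) {j : ℕ}
    (hj : j ≤ 2 * ω.Mv + ω.τ hr h + 1) (h1 : j ≠ 2 * ω.Mv + 1 + i') (h2 : j ≠ 2 * ω.Mv + 2 + i') :
    0 < sdot (ω.Qp hr h (2 * ω.Mv + 1 + i')) (ω.Qp hr h (2 * ω.Mv + 1 + i' + 1)) (ω.Qp hr h j) := by
  have hM := three_le_Mv hr h
  have hfM := fh_add_Mv (ω := ω) h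
  have hτ := τ_le (ω := ω) (hr := hr) h
  have hlen := tailPts_length (ω := ω) (hr := hr) h
  obtain ⟨t1, t2, t3, -, -⟩ := table_local _ _ _ hc
  rw [Qp_tailPts h hi'.le, show 2 * ω.Mv + 1 + i' + 1 = 2 * ω.Mv + 1 + (i' + 1) by ring, Qp_tailPts h (by omega)]
  rcases Nat.eq_zero_or_pos j with rfl | hjpos
  · -- from `m₀`
    rw [Qp_zero h, add_comm r.base, add_comm r.base, add_comm r.base, sdot_add]
    exact t1 i' (by omega) (by omega)
  · by_cases hjm : j ≤ 2 * ω.Mv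
    · -- from an inner point of the walk part
      rw [Qp_mid h (by omega) (by omega)]
      obtain ⟨i, hi, hpar, σ, e, hσ⟩ := vtx_eq_innerPt (ω := ω) (j := 2 * ω.2.firstHit + j) (by omega) (by omega)
      rw [e, innerPt]
      -- the segment offsets
      obtain ⟨sg, hsg, e1, e2⟩ := tailSeg_mem (ω := ω) (hr := hr) h hi'
      rw [Qp_tailPts h hi'.le] at e1
      rw [show 2 * ω.Mv + 2 + i' = 2 * ω.Mv + 1 + (i' + 1) by ring, Qp_tailPts h (by omega)] at e2
      have e1' := add_left_cancel e1
      have e2' := add_left_cancel e2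
      rw [e1', e2']
      have hsgmem : (sg.1 = ω.1.offset ∨ sg.1 ∈ tailOffs ω.2.firstSide (ω.z1 hr h) ω.1) ∧ sg.2 ∈ tailOffs ω.2.firstSide (ω.z1 hr h) ω.1 := by
        unfold tailSegs at hsg
        have h1 := List.of_mem_zip hsg
        simp only [List.mem_cons] at h1
        exact h1
      have hu : 0 ≤ sg.1.1 ∧ sg.1.1 ≤ 4 ∧ 0 ≤ sg.1.2 ∧ sg.1.2 ≤ 4 := by
        rcases hsgmem.1 with e | hm
        · rw [e]; cases ω.1 <;> simp [Side.offset]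
        · have := tailOffs_mem _ _ _ _ hm; omega
      have hu' : 0 ≤ sg.2.1 ∧ sg.2.1 ≤ 4 ∧ 0 ≤ sg.2.2 ∧ sg.2.2 ≤ 4 := by
        have := tailOffs_mem _ _ _ _ hsgmem.2; omega
      refine sdot_pos_split r (ω.2.fc i) hu hu' σ.inOff_mem fun d hd hg => ?_
      refine table_tailSeg_inner _ _ _ hc sg hsg d hd σ ?_
      by_cases hd0 : d = (0, 0)
      · -- the face is `r`: the arc is the first one, `σ ∈ {z₀, z₁}`
        right
        have hfc : ω.2.fc i = r := by rw [hg, hd0]; simp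
        have hi0 : i = ω.2.firstHit := by
          by_contra hne
          exact ω.fc_ne hr h (by omega) hi hfc
        subst hi0
        rw [hfc, ω.2.nth_firstHit, (ω.2.exitSide_spec hr (ω.fh_lt h)).1] at hσ
        simp only [List.mem_cons, List.not_mem_nil, or_false] at hσ
        rcases hσ with hσ | hσ
        · left; exact r.side_injective hσ
        · right; exact r.side_injective hσ
      · left; exact hd0
    · -- from another tail point (or `E`)
      obtain ⟨j', rfl⟩ : ∃ j', j = 2 * ω.Mv + 1 + j' := ⟨j - (2 * ω.Mv + 1), by omega⟩
      rw [Qp_tailPts h (by omega), add_comm r.base, add_comm r.base, add_comm r.base, sdot_add]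
      exact t2 ⟨i', by omega⟩ ⟨j', by omega⟩ (by simp; omega) (by simp; omega) (by simp; omega) (by simp; omega)

/-- **Hopf's hypothesis for the open path of an excursion**: every segment is seen from every
other vertex under an angle `< π/2`. [folklore] -/
theorem subtQ (h : ω.IsB2a) (hc : Canon ω.2.firstSide (ω.z1 hr h) ω.1) {k j : ℕ}
    (hk : k ≤ 2 * ω.Mv + ω.τ hr h) (hj : j ≤ 2 * ω.Mv + ω.τ hr h + 1) (h1 : j ≠ k) (h2 : j ≠ k + 1) :
    0 < sdot (ω.Qp hr h k) (ω.Qp hr h (k + 1)) (ω.Qp hr h j) := by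
  have hM := three_le_Mv hr h
  have hτ := τ_le (ω := ω) (hr := hr) h
  have hτ0 := τ_pos (ω := ω) (hr := hr) h
  rcases Nat.eq_zero_or_pos k with rfl | hkpos
  · exact subt_k0 h (by omega) hj
  by_cases hkm : k ≤ 2 * ω.Mv
  · rcases Nat.eq_zero_or_pos j with rfl | hjpos
    · exact subt_kmid_j0 h hkpos hkm
    by_cases hjm : j ≤ 2 * ω.Mv + 1
    · exact subt_kmid_jmid h hkpos hkm hjpos hjm h1 h2
    · obtain ⟨i', rfl⟩ : ∃ i', j = 2 * ω.Mv + 2 + i' := ⟨j - (2 * ω.Mv + 2), by omega⟩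
      rw [Qp_tail h]
      exact subt_kmid_jtail h hc hkpos hkm (by omega)
  · obtain ⟨i', rfl⟩ : ∃ i', k = 2 * ω.Mv + 1 + i' := ⟨k - (2 * ω.Mv + 1), by omega⟩
    exact subt_ktail h hc (by omega) hj h1 (by omega)

/-! #### The total turning of the open path -/

variable (ω hr) in
/-- The complex open path. [folklore] -/
def qQ (h : ω.IsB2a) (j : ℕ) : ℂ := toC (ω.Qp hr h j)

variable (ω hr) in
/-- Hopf's index `m`: the path has the vertices `0, …, m + 1`. [folklore] -/
def mQ (h : ω.IsB2a) : ℕ := 2 * ω.Mv + ω.τ hr h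

variable (ω hr) in
/-- The exterior angle of the open path at its vertex `j + 1`. [folklore] -/
def extQ (h : ω.IsB2a) (j : ℕ) : ℝ :=
  ((Complex.arg (ω.qQ hr h (j + 2) - ω.qQ hr h (j + 1)) : Real.Angle) -
    (Complex.arg (ω.qQ hr h (j + 1) - ω.qQ hr h j) : Real.Angle)).toReal

/-- **Hopf's identity for the open path of an excursion.** [folklore] -/
theorem hopfQ (h : ω.IsB2a) (hc : Canon ω.2.firstSide (ω.z1 hr h) ω.1) :
    ∑ j ∈ Finset.range (ω.mQ hr h), ω.extQ hr h j =
      ∑ i ∈ Finset.range (ω.mQ hr h), ((Complex.arg (ω.qQ hr h (ω.mQ hr h + 1) - ω.qQ hr h (i + 1)) : Real.Angle) -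
          (Complex.arg (ω.qQ hr h (ω.mQ hr h + 1) - ω.qQ hr h i) : Real.Angle)).toReal +
        sweep (ω.qQ hr h 0) (fun k => ω.qQ hr h (k + 1)) (ω.mQ hr h) := by
  have := Hopf.hopf_open (ω.qQ hr h) (ω.mQ hr h) fun k j hk hj h1 h2 => by
    rw [qQ, qQ, qQ, ← toC_sub, ← toC_sub, re_toC_mul_conj]
    have := ω.subtQ h hc (by unfold mQ at hk; exact hk) (by unfold mQ at hj; exact hj) h1 h2
    simp only [sdot] at this
    simp only [Prod.fst_sub, Prod.snd_sub]
    exact_mod_cast this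
  unfold extQ
  rw [this, sweep]
  rfl

/-- The in-direction at the entry point of the arc `fh + t` is a positive multiple of the normal.
[folklore] -/
theorem qQ_in (h : ω.IsB2a) {t : ℕ} (ht : t < ω.Mv) :
    ∃ c : ℝ, 0 < c ∧ ω.qQ hr h (2 * t + 1) - ω.qQ hr h (2 * t) = c * toC (ω.2.sIn (ω.2.firstHit + t)).nIn := by
  have hfM := fh_add_Mv (ω := ω) h
  rcases Nat.eq_zero_or_pos t with rfl | hpos
  · refine ⟨1, one_pos, ?_⟩
    rw [qQ, qQ, mul_zero, zero_add, Qp_one h, Qp_zero h, add_zero, (ω.fc_fh hr h).2.1, ← toC_sub, Side.inOff]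
    push_cast; rw [one_mul]; congr 1; abel
  · have hi : ω.2.firstHit + t < ω.2.arcs.length := by omega
    obtain ⟨c, hc, e⟩ := YBWalk.cvtx_in (γ := ω.2) hi
    refine ⟨c, hc, ?_⟩
    rw [qQ, qQ, Qp_mid h (by omega) (by omega), Qp_mid h (by omega) (by omega), ← YBWalk.cvtx, ← YBWalk.cvtx,
      show 2 * ω.2.firstHit + (2 * t + 1) = 2 * (ω.2.firstHit + t) + 1 by ring,
      show 2 * ω.2.firstHit + 2 * t = 2 * (ω.2.firstHit + t) by ring, e]

/-- The chord of an arc in the open path. [folklore] -/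
theorem qQ_chord (h : ω.IsB2a) {t : ℕ} (ht : t < ω.Mv) :
    ω.qQ hr h (2 * t + 2) - ω.qQ hr h (2 * t + 1) = toC (chordVec (ω.2.sIn (ω.2.firstHit + t)) (ω.2.sOut (ω.2.firstHit + t))) := by
  have hfM := fh_add_Mv (ω := ω) h
  have hi : ω.2.firstHit + t < ω.2.arcs.length := by omega
  rw [qQ, qQ, Qp_mid h (by omega) (by omega), Qp_mid h (by omega) (by omega), ← YBWalk.cvtx, ← YBWalk.cvtx,
    show 2 * ω.2.firstHit + (2 * t + 2) = 2 * (ω.2.firstHit + t) + 2 by ring,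
    show 2 * ω.2.firstHit + (2 * t + 1) = 2 * (ω.2.firstHit + t) + 1 by ring, YBWalk.cvtx_chord hi]

/-- The out-direction at the exit point of an arc is a positive multiple of the outward normal. [folklore] -/
theorem qQ_out (h : ω.IsB2a) {t : ℕ} (ht : t < ω.Mv) :
    ∃ c : ℝ, 0 < c ∧ ω.qQ hr h (2 * t + 3) - ω.qQ hr h (2 * t + 2) = c * (-toC (ω.2.sOut (ω.2.firstHit + t)).nIn) := by
  have hfM := fh_add_Mv (ω := ω) h
  have hi : ω.2.firstHit + t < ω.2.arcs.length := by omega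
  obtain ⟨c, hc, e⟩ := YBWalk.cvtx_out (γ := ω.2) hi
  refine ⟨c, hc, ?_⟩
  rw [qQ, qQ, Qp_mid h (by omega) (by omega), Qp_mid h (by omega) (by omega), ← YBWalk.cvtx, ← YBWalk.cvtx,
    show 2 * ω.2.firstHit + (2 * t + 3) = 2 * (ω.2.firstHit + t) + 3 by ring,
    show 2 * ω.2.firstHit + (2 * t + 2) = 2 * (ω.2.firstHit + t) + 2 by ring, e]

/-- **The turning of the walk part is its right-angle winding.** [folklore] -/
theorem sum_extQ_walk (h : ω.IsB2a) :
    ∑ j ∈ Finset.range (2 * ω.Mv), ω.extQ hr h j =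
      ∑ t ∈ Finset.range ω.Mv, arcTurn (π / 2) (ω.2.sIn (ω.2.firstHit + t)) (ω.2.sOut (ω.2.firstHit + t)) := by
  have hpair : ∀ (g : ℕ → ℝ) (n : ℕ), ∑ j ∈ Finset.range (2 * n), g j =
      ∑ i ∈ Finset.range n, (g (2 * i) + g (2 * i + 1)) := by
    intro g n
    induction n with
    | zero => simp
    | succ n ih => rw [show 2 * (n + 1) = 2 * n + 1 + 1 by ring, Finset.sum_range_succ, Finset.sum_range_succ, ih,
        Finset.sum_range_succ]; ring
  rw [hpair]
  refine Finset.sum_congr rfl fun t ht => ?_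
  rw [Finset.mem_range] at ht
  obtain ⟨c₁, hc₁, h₁⟩ := ω.qQ_in h ht
  obtain ⟨c₂, hc₂, h₂⟩ := ω.qQ_out h ht
  have hfM := fh_add_Mv (ω := ω) h
  have hst := (YBWalk.side_sIn (γ := ω.2) (i := ω.2.firstHit + t) (by omega)).2.2
  unfold extQ
  rw [show 2 * t + 1 + 1 = 2 * t + 2 by ring, show 2 * t + 1 + 2 = 2 * t + 3 by ring, ω.qQ_chord h ht, h₁, h₂,
    Complex.arg_real_mul _ hc₁, Complex.arg_real_mul _ hc₂]
  exact ext_angles_eq_arcTurn _ _ hst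

/-- The winding of the excursion as a sum over its arcs. [folklore] -/
theorem WE_eq_sum (h : ω.IsB2a) (Θ : ℤ → ℝ) :
    ω.WE Θ = ∑ t ∈ Finset.range (ω.Mv - 1),
      arcTurn (Θ (ω.2.fc (ω.2.firstHit + 1 + t)).1) (ω.2.sIn (ω.2.firstHit + 1 + t)) (ω.2.sOut (ω.2.firstHit + 1 + t)) := by
  have hfM := fh_add_Mv (ω := ω) h
  unfold WE
  rw [List.sum_map_eq_sum_range_getD _ (origin, origin), List.length_drop]
  rw [show ω.2.arcs.length - (ω.2.firstHit + 1) = ω.Mv - 1 by omega]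
  refine Finset.sum_congr rfl fun t ht => ?_
  rw [Finset.mem_range] at ht
  have hi : ω.2.firstHit + 1 + t < ω.2.arcs.length := by omega
  rw [List.getD_eq_getElem?_getD, List.getElem?_drop, List.getElem?_eq_getElem (by omega), Option.getD_some]
  have := arcTurnOf_eq_arcTurn (Θ := Θ) (YBWalk.arcFace_arcAt hi).1
  rw [YBWalk.sIn, YBWalk.sOut]
  rw [YBWalk.arcAt, List.getD_eq_getElem?_getD, List.getElem?_eq_getElem hi, Option.getD_some] at this ⊢
  exact this

/-- **The turning of the walk part**: the first arc plus the excursion. [folklore] -/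
theorem sum_extQ_walk_eq (h : ω.IsB2a) :
    ∑ j ∈ Finset.range (2 * ω.Mv), ω.extQ hr h j =
      arcTurn (π / 2) ω.2.firstSide (ω.z1 hr h) + ω.WE (fun _ => π / 2) := by
  have hM := three_le_Mv hr h
  rw [ω.sum_extQ_walk h, ω.WE_eq_sum h, show ω.Mv = (ω.Mv - 1) + 1 from by omega, Finset.sum_range_succ',
    add_zero, (ω.fc_fh hr h).2.1, (ω.fc_fh hr h).2.2, z1, add_comm]
  congr 1
  refine Finset.sum_congr (by congr 1) fun t _ => ?_
  rw [show ω.2.firstHit + (t + 1) = ω.2.firstHit + 1 + t by ring]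

/-! #### The closed polygon of the excursion and the two swept angles -/

variable (ω hr) in
/-- **The closed polygon `J`**: the inner points of the excursion, closed through `r` by the chord
from the return side to the exit side (`2 Mv` vertices, `pJ (2 Mv) = pJ 0`). [folklore] -/
def pJ (h : ω.IsB2a) (k : ℕ) : ℂ :=
  if k = 2 * ω.Mv - 1 then toC (r.base + (ω.1).inOff) else ω.qQ hr h (k % (2 * ω.Mv) + 2)

variable (ω hr) in
/-- The winding angle of `J` around `b`. [folklore] -/
def AJ (h : ω.IsB2a) (b : ℂ) : ℝ := sweep b (ω.pJ hr h) (2 * ω.Mv)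

/-- The excursion part of `J`. [folklore] -/
theorem pJ_lt (h : ω.IsB2a) {k : ℕ} (hk : k ≤ 2 * ω.Mv - 2) : ω.pJ hr h k = ω.qQ hr h (k + 2) := by
  have hM := three_le_Mv hr h
  rw [pJ, if_neg (by omega), Nat.mod_eq_of_lt (by omega)]

/-- The closing vertex of `J` is `c₂`. [folklore] -/
theorem pJ_c₂ (h : ω.IsB2a) : ω.pJ hr h (2 * ω.Mv - 1) = toC (r.base + (ω.1).inOff) := by rw [pJ, if_pos rfl]

/-- `J` returns to `c₁`. [folklore] -/
theorem pJ_top (h : ω.IsB2a) : ω.pJ hr h (2 * ω.Mv) = ω.qQ hr h 2 := by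
  have hM := three_le_Mv hr h
  rw [pJ, if_neg (by omega), Nat.mod_self]

/-- `J` is closed. [folklore] -/
theorem pJ_closed (h : ω.IsB2a) : ω.pJ hr h (2 * ω.Mv) = ω.pJ hr h 0 := by
  rw [pJ_top h, pJ_lt h (by omega)]

/-- The winding angle of `J` split off its two closing steps. [folklore] -/
theorem AJ_split (h : ω.IsB2a) (b : ℂ) :
    ω.AJ hr h b = ∑ k ∈ Finset.range (2 * ω.Mv - 2), angAt b (ω.qQ hr h (k + 2)) (ω.qQ hr h (k + 3)) +
      angAt b (ω.qQ hr h (2 * ω.Mv)) (toC (r.base + (ω.1).inOff)) +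
      angAt b (toC (r.base + (ω.1).inOff)) (ω.qQ hr h 2) := by
  have hM := three_le_Mv hr h
  rw [AJ, sweep, show 2 * ω.Mv = 2 * ω.Mv - 2 + 1 + 1 by omega, Finset.sum_range_succ, Finset.sum_range_succ,
    show 2 * ω.Mv - 2 + 1 + 1 = 2 * ω.Mv by omega, show 2 * ω.Mv - 2 + 1 = 2 * ω.Mv - 1 by omega, pJ_top h, pJ_c₂ h,
    pJ_lt h le_rfl, show 2 * ω.Mv - 2 + 2 = 2 * ω.Mv by omega]
  congr 2
  refine Finset.sum_congr rfl fun k hk => ?_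
  rw [Finset.mem_range] at hk
  rw [pJ_lt h (by omega), pJ_lt h (by omega)]

/-- A term of the sweep into a point is the angle at that point. [folklore] -/
theorem toReal_into_eq_angAt {w P₀ P₁ : ℂ} (h0 : P₀ ≠ w) (h1 : P₁ ≠ w) :
    ((Complex.arg (w - P₁) : Real.Angle) - (Complex.arg (w - P₀) : Real.Angle)).toReal = angAt w P₀ P₁ := by
  unfold angAt
  congr 1
  rw [← neg_sub P₁ w, ← neg_sub P₀ w, Complex.arg_neg_coe_angle (sub_ne_zero.2 h1),
    Complex.arg_neg_coe_angle (sub_ne_zero.2 h0)]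
  abel

/-- The vertices of the open path are distinct (through Hopf's hypothesis). [folklore] -/
theorem qQ_ne (h : ω.IsB2a) (hc : Canon ω.2.firstSide (ω.z1 hr h) ω.1) {i j : ℕ} (hi : i ≤ ω.mQ hr h + 1)
    (hj : j ≤ ω.mQ hr h + 1) (hij : i ≠ j) : ω.qQ hr h i ≠ ω.qQ hr h j := by
  have hM := three_le_Mv hr h
  have hm : ω.mQ hr h = 2 * ω.Mv + ω.τ hr h := rfl
  intro e
  -- use a segment at `i` (or ending at `i`) seen from `j`
  wlog hlt : i < j generalizing i j
  · exact this hj hi (Ne.symm hij) e.symm (by omega)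
  by_cases hji : j = i + 1
  · subst hji
    rcases Nat.lt_or_ge (i + 1) (ω.mQ hr h + 1) with hlt' | hge
    · -- the segment `[q (i+1), q (i+2)]` seen from `q i = q (i+1)`
      have := ω.subtQ h hc (k := i + 1) (j := i) (by omega) (by omega) (by omega) (by omega)
      rw [qQ, qQ] at e
      rw [toC_injective e, sdot] at this
      simp at this
    · -- `i + 1` is the last vertex: the segment `[q (i-1), q i]` seen from `q (i+1) = q i`
      have := ω.subtQ h hc (k := i - 1) (j := i + 1) (by omega) hj (by omega) (by omega)
      rw [qQ, qQ] at e
      rw [show i - 1 + 1 = i by omega, toC_injective e, sdot] at this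
      simp at this
  · have := ω.subtQ h hc (k := i) (j := j) (by omega) hj (by omega) hji
    rw [qQ, qQ] at e
    rw [toC_injective e, sdot] at this
    simp at this

/-- **The swept angle from `m₀` in terms of the winding angle of `J`**: the terms along the
excursion are those of `J`; the remaining ones are local. [folklore] -/
theorem S₂_eq (h : ω.IsB2a) :
    sweep (ω.qQ hr h 0) (fun k => ω.qQ hr h (k + 1)) (ω.mQ hr h) =
      ω.AJ hr h (ω.qQ hr h 0) +
        (angAt (ω.qQ hr h 0) (ω.qQ hr h 1) (ω.qQ hr h 2) -
          angAt (ω.qQ hr h 0) (ω.qQ hr h (2 * ω.Mv)) (toC (r.base + (ω.1).inOff)) -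
          angAt (ω.qQ hr h 0) (toC (r.base + (ω.1).inOff)) (ω.qQ hr h 2) +
          ∑ i ∈ Finset.range (ω.τ hr h + 1), angAt (ω.qQ hr h 0) (ω.qQ hr h (2 * ω.Mv + i)) (ω.qQ hr h (2 * ω.Mv + 1 + i))) := by
  have hM := three_le_Mv hr h
  set b := ω.qQ hr h 0
  set F : ℕ → ℝ := fun k => angAt b (ω.qQ hr h (k + 1)) (ω.qQ hr h (k + 1 + 1)) with hF
  have h0 : sweep b (fun k => ω.qQ hr h (k + 1)) (ω.mQ hr h) = ∑ k ∈ Finset.range (ω.mQ hr h), F k := rfl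
  have h1 : ∑ k ∈ Finset.range (ω.mQ hr h), F k =
      ∑ k ∈ Finset.range (2 * ω.Mv - 1), F k + ∑ i ∈ Finset.range (ω.τ hr h + 1), F (2 * ω.Mv - 1 + i) := by
    rw [mQ, show 2 * ω.Mv + ω.τ hr h = (2 * ω.Mv - 1) + (ω.τ hr h + 1) by omega, Finset.sum_range_add]
  have h2 : ∑ k ∈ Finset.range (2 * ω.Mv - 1), F k = F 0 + ∑ k ∈ Finset.range (2 * ω.Mv - 2), F (k + 1) := by
    rw [show 2 * ω.Mv - 1 = 2 * ω.Mv - 2 + 1 by omega, Finset.sum_range_succ', add_comm]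
  have h3 : ∑ k ∈ Finset.range (2 * ω.Mv - 2), F (k + 1) =
      ∑ k ∈ Finset.range (2 * ω.Mv - 2), angAt b (ω.qQ hr h (k + 2)) (ω.qQ hr h (k + 3)) := by
    refine Finset.sum_congr rfl fun k _ => ?_; simp only [hF]
  have h4 : ∑ i ∈ Finset.range (ω.τ hr h + 1), F (2 * ω.Mv - 1 + i) =
      ∑ i ∈ Finset.range (ω.τ hr h + 1), angAt b (ω.qQ hr h (2 * ω.Mv + i)) (ω.qQ hr h (2 * ω.Mv + 1 + i)) := by
    refine Finset.sum_congr rfl fun i _ => ?_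
    simp only [hF]
    rw [show 2 * ω.Mv - 1 + i + 1 = 2 * ω.Mv + i by omega, show 2 * ω.Mv + i + 1 = 2 * ω.Mv + 1 + i by omega]
  have hF0 : F 0 = angAt b (ω.qQ hr h 1) (ω.qQ hr h 2) := rfl
  rw [h0, h1, h2, h3, h4, hF0, ω.AJ_split h b]
  ring

/-- **The swept angle into `w` in terms of the winding angle of `J`.** [folklore] -/
theorem S₁_eq (h : ω.IsB2a) (hc : Canon ω.2.firstSide (ω.z1 hr h) ω.1) :
    ∑ i ∈ Finset.range (ω.mQ hr h), ((Complex.arg (ω.qQ hr h (ω.mQ hr h + 1) - ω.qQ hr h (i + 1)) : Real.Angle) -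
        (Complex.arg (ω.qQ hr h (ω.mQ hr h + 1) - ω.qQ hr h i) : Real.Angle)).toReal =
      ω.AJ hr h (ω.qQ hr h (ω.mQ hr h + 1)) +
        (angAt (ω.qQ hr h (ω.mQ hr h + 1)) (ω.qQ hr h 0) (ω.qQ hr h 1) +
          angAt (ω.qQ hr h (ω.mQ hr h + 1)) (ω.qQ hr h 1) (ω.qQ hr h 2) -
          angAt (ω.qQ hr h (ω.mQ hr h + 1)) (ω.qQ hr h (2 * ω.Mv)) (toC (r.base + (ω.1).inOff)) -
          angAt (ω.qQ hr h (ω.mQ hr h + 1)) (toC (r.base + (ω.1).inOff)) (ω.qQ hr h 2) +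
          ∑ i ∈ Finset.range (ω.τ hr h), angAt (ω.qQ hr h (ω.mQ hr h + 1)) (ω.qQ hr h (2 * ω.Mv + i))
            (ω.qQ hr h (2 * ω.Mv + 1 + i))) := by
  have hM := three_le_Mv hr h
  set w := ω.qQ hr h (ω.mQ hr h + 1)
  -- every term is an angle at `w`
  rw [Finset.sum_congr rfl fun i hi => toReal_into_eq_angAt
    (ω.qQ_ne h hc (by rw [Finset.mem_range] at hi; omega) le_rfl (by rw [Finset.mem_range] at hi; omega))
    (ω.qQ_ne h hc (by rw [Finset.mem_range] at hi; omega) le_rfl (by rw [Finset.mem_range] at hi; omega))]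
  set G : ℕ → ℝ := fun i => angAt w (ω.qQ hr h i) (ω.qQ hr h (i + 1)) with hG
  have h1 : ∑ i ∈ Finset.range (ω.mQ hr h), G i =
      ∑ i ∈ Finset.range (2 * ω.Mv), G i + ∑ i ∈ Finset.range (ω.τ hr h), G (2 * ω.Mv + i) := by
    rw [mQ, Finset.sum_range_add]
  have h2 : ∑ i ∈ Finset.range (2 * ω.Mv), G i = G 0 + G 1 + ∑ k ∈ Finset.range (2 * ω.Mv - 2), G (k + 2) := by
    have e : 2 * ω.Mv = 2 * ω.Mv - 2 + 1 + 1 := by omega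
    conv_lhs => rw [e, Finset.sum_range_succ', Finset.sum_range_succ']
    simp only [zero_add]
    ring
  have h3 : ∑ k ∈ Finset.range (2 * ω.Mv - 2), G (k + 2) =
      ∑ k ∈ Finset.range (2 * ω.Mv - 2), angAt w (ω.qQ hr h (k + 2)) (ω.qQ hr h (k + 3)) := by
    refine Finset.sum_congr rfl fun k _ => ?_; simp only [hG]
  have h4 : ∑ i ∈ Finset.range (ω.τ hr h), G (2 * ω.Mv + i) =
      ∑ i ∈ Finset.range (ω.τ hr h), angAt w (ω.qQ hr h (2 * ω.Mv + i)) (ω.qQ hr h (2 * ω.Mv + 1 + i)) := by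
    refine Finset.sum_congr rfl fun i _ => ?_
    simp only [hG]
    rw [show 2 * ω.Mv + i + 1 = 2 * ω.Mv + 1 + i by omega]
  have hG0 : G 0 = angAt w (ω.qQ hr h 0) (ω.qQ hr h 1) := rfl
  have hG1 : G 1 = angAt w (ω.qQ hr h 1) (ω.qQ hr h 2) := rfl
  show ∑ i ∈ Finset.range (ω.mQ hr h), G i = _
  rw [h1, h2, h3, h4, hG0, hG1, ω.AJ_split h w]
  ring

/-- **The total turning splits into the walk part and the tail.** [folklore] -/
theorem T_eq (h : ω.IsB2a) :
    ∑ j ∈ Finset.range (ω.mQ hr h), ω.extQ hr h j =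
      arcTurn (π / 2) ω.2.firstSide (ω.z1 hr h) + ω.WE (fun _ => π / 2) +
        ∑ i ∈ Finset.range (ω.τ hr h), ω.extQ hr h (2 * ω.Mv + i) := by
  rw [mQ, Finset.sum_range_add, ω.sum_extQ_walk_eq h]

/-! #### The winding angle of `J` vanishes at `m₀` and at `w` -/

/-- An arc between non-opposite sides is not straight. [folklore] -/
theorem _root_.Literature.Probability.RandomPlanarGeometry.SAW.YangBaxter.arcKind_ne_straight {s t : Side}
    (h : t ≠ s.opp) : arcKind s t ≠ .straight := by
  revert h; cases s <;> cases t <;> decide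

variable (ω hr) in
/-- The vertices of `J` as lattice points. [folklore] -/
def pJpt (h : ω.IsB2a) (k : ℕ) : ℤ × ℤ :=
  if k = 2 * ω.Mv - 1 then r.base + (ω.1).inOff else ω.Qp hr h (k % (2 * ω.Mv) + 2)

/-- The vertices of `J` are lattice points. [folklore] -/
theorem pJ_eq_toC (h : ω.IsB2a) (k : ℕ) : ω.pJ hr h k = toC (ω.pJpt hr h k) := by
  unfold pJ pJpt qQ; split_ifs <;> rfl

/-- The excursion part of `J`, as lattice points. [folklore] -/
theorem pJpt_lt (h : ω.IsB2a) {k : ℕ} (hk : k ≤ 2 * ω.Mv - 2) : ω.pJpt hr h k = ω.Qp hr h (k + 2) := by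
  have hM := three_le_Mv hr h
  rw [pJpt, if_neg (by omega), Nat.mod_eq_of_lt (by omega)]

/-- The closing vertex of `J`, as a lattice point. [folklore] -/
theorem pJpt_c₂ (h : ω.IsB2a) : ω.pJpt hr h (2 * ω.Mv - 1) = r.base + (ω.1).inOff := by rw [pJpt, if_pos rfl]

/-- `J` returns to `c₁`, as lattice points. [folklore] -/
theorem pJpt_top (h : ω.IsB2a) : ω.pJpt hr h (2 * ω.Mv) = ω.Qp hr h 2 := by
  have hM := three_le_Mv hr h
  rw [pJpt, if_neg (by omega), Nat.mod_self]

/-- The vertices of `J` are inner points: of faces of the excursion (`≠ r`), or `c₁`, `c₂`.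
[folklore] -/
theorem pJpt_cases (h : ω.IsB2a) {k : ℕ} (hk : k ≤ 2 * ω.Mv) :
    (∃ i, ω.2.firstHit < i ∧ i < ω.2.arcs.length ∧ ∃ σ, ω.pJpt hr h k = innerPt (ω.2.fc i) σ) ∨
      ω.pJpt hr h k = innerPt r (ω.z1 hr h) ∨ ω.pJpt hr h k = innerPt r ω.1 := by
  have hM := three_le_Mv hr h
  have hfM := fh_add_Mv (ω := ω) h
  rcases Nat.lt_or_ge k (2 * ω.Mv - 1) with hlt | hge
  · rw [pJpt_lt h (by omega)]
    rcases Nat.eq_zero_or_pos k with rfl | hpos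
    · right; left; rw [zero_add, Qp_two h, innerPt]
    · left
      rw [Qp_mid h (by omega) (by omega)]
      obtain ⟨i, hi, hpar, σ, e, -⟩ := vtx_eq_innerPt (ω := ω) (j := 2 * ω.2.firstHit + (k + 2)) (by omega) (by omega)
      exact ⟨i, by omega, hi, σ, e⟩
  · rcases hge.lt_or_eq with hgt | heq
    · have : k = 2 * ω.Mv := by omega
      subst this
      right; left; rw [pJpt_top h, Qp_two h, innerPt]
    · right; right; rw [← heq, pJpt_c₂ h, innerPt]

/-- **The segments of `J` are seen under acute angles from the midpoints of the prefix** (including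
`m₀`). [folklore] -/
theorem sdot_pJpt_midPt (h : ω.IsB2a) {i : ℕ} (hi : i ≤ ω.2.firstHit) {k : ℕ} (hk : k < 2 * ω.Mv) :
    0 < sdot (ω.pJpt hr h k) (ω.pJpt hr h (k + 1)) (midPt (ω.2.nth i)) := by
  have hM := three_le_Mv hr h
  have hfM := fh_add_Mv (ω := ω) h
  rcases Nat.lt_or_ge k (2 * ω.Mv - 2) with hlt | hge
  · -- a segment of the excursion: `[vtx (2fh+k+2), vtx (2fh+k+3)]`
    rw [pJpt_lt h hlt.le, pJpt_lt h (by omega), Qp_mid h (by omega) (by omega), Qp_mid h (by omega) (by omega),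
      show 2 * ω.2.firstHit + (k + 1 + 2) = 2 * ω.2.firstHit + (k + 2) + 1 by ring]
    rcases Nat.even_or_odd k with ⟨t, ht⟩ | ⟨t, ht⟩
    · -- `K = 2 fh + k + 2` even: crossing at `mids[fh + t + 1]`
      set j := ω.2.firstHit + t with hj_def
      have hK : 2 * ω.2.firstHit + (k + 2) = 2 * j + 2 := by omega
      have hj : j < ω.2.arcs.length := by omega
      have hj1 : j + 1 < ω.2.arcs.length := by omega
      rw [hK]
      have eν : (ω.2.sIn (j + 1)).nIn = -(ω.2.sOut j).nIn :=
        nIn_eq_neg_of_side_eq (((YBWalk.side_sIn hj).2.1).trans ((YBWalk.side_sIn hj1).1).symm) (YBWalk.fc_succ_ne hj1)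
      have ek : ω.2.vtx (2 * j + 2) = midPt (ω.2.mids[j + 1]'(YBWalk.lt_length_of_lt_arcs hj)) - (ω.2.sIn (j + 1)).nIn := by
        rw [YBWalk.vtx_even hj, YBWalk.ptOut, innerPt_eq, (YBWalk.side_sIn hj).2.1, eν, sub_neg_eq_add]
      have ek1 : ω.2.vtx (2 * j + 2 + 1) = midPt (ω.2.mids[j + 1]'(YBWalk.lt_length_of_lt_arcs hj)) + (ω.2.sIn (j + 1)).nIn := by
        rw [show 2 * j + 2 + 1 = 2 * (j + 1) + 1 by ring, YBWalk.vtx_odd hj1, YBWalk.ptIn, innerPt_eq, (YBWalk.side_sIn hj1).1]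
      rw [ek, ek1, sdot_cross_eq, Side.nIn_sq]
      have hne : ω.2.mids[j + 1]'(YBWalk.lt_length_of_lt_arcs hj) ≠ ω.2.nth i := by
        rw [← ω.2.nth_eq_getElem]
        intro hh; have := ω.2.nth_inj (by omega) (by omega) hh; omega
      have := one_lt_dist_midPt hne
      simp only [Prod.fst_sub, Prod.snd_sub] at this
      omega
    · -- odd: a chord
      set j := ω.2.firstHit + t + 1 with hj_def
      have hK : 2 * ω.2.firstHit + (k + 2) = 2 * j + 1 := by omega
      have hj : j < ω.2.arcs.length := by omega
      rw [hK, YBWalk.vtx_odd hj, show 2 * j + 1 + 1 = 2 * j + 2 by ring, YBWalk.vtx_even hj, YBWalk.ptIn, YBWalk.ptOut]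
      exact sdot_midPt_pos _ (YBWalk.side_sIn hj).2.2 _
  · rcases Nat.lt_or_ge k (2 * ω.Mv - 1) with hlt' | hge'
    · -- the crossing at the return side: `[q_last, c₂]`
      have hk' : k = 2 * ω.Mv - 2 := by omega
      subst hk'
      rw [pJpt_lt h le_rfl, show 2 * ω.Mv - 2 + 2 = 2 * ω.Mv by omega, Qp_qlast h,
        show 2 * ω.Mv - 2 + 1 = 2 * ω.Mv - 1 by omega, pJpt_c₂ h, Side.inOff, ← add_assoc, ← midPt_side, add_sub_assoc', ← midPt_side]
      rw [sdot_cross_eq, Side.nIn_sq]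
      have hne : r.side ω.1 ≠ ω.2.nth i := by
        intro hh
        have := ω.2.nth_inj (i := ω.2.arcs.length) (j := i) le_rfl (by omega) (ω.2.nth_length.trans hh)
        omega
      have := one_lt_dist_midPt hne
      simp only [Prod.fst_sub, Prod.snd_sub] at this
      omega
    · -- the closing chord `[c₂, c₁]`
      have hk' : k = 2 * ω.Mv - 1 := by omega
      subst hk'
      rw [pJpt_c₂ h, show 2 * ω.Mv - 1 + 1 = 2 * ω.Mv by omega, pJpt_top h, Qp_two h, ← innerPt, ← innerPt]
      refine sdot_midPt_pos _ ?_ _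
      have := (ω.2.sides_distinct hr h.1).2.2
      rw [ω.returnSide_of_isB2a h] at this
      exact this

/-- The vertices of `J`, precisely: entry/exit inner points of excursion arcs, or `c₁`, `c₂`.
[folklore] -/
theorem pJpt_cases' (h : ω.IsB2a) {k : ℕ} (hk : k ≤ 2 * ω.Mv) :
    (∃ i, ω.2.firstHit < i ∧ i < ω.2.arcs.length ∧
        (ω.pJpt hr h k = innerPt (ω.2.fc i) (ω.2.sIn i) ∨ ω.pJpt hr h k = innerPt (ω.2.fc i) (ω.2.sOut i))) ∨
      ω.pJpt hr h k = innerPt r (ω.z1 hr h) ∨ ω.pJpt hr h k = innerPt r ω.1 := by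
  have hM := three_le_Mv hr h
  have hfM := fh_add_Mv (ω := ω) h
  rcases Nat.lt_or_ge k (2 * ω.Mv - 1) with hlt | hge
  · rw [pJpt_lt h (by omega)]
    rcases Nat.eq_zero_or_pos k with rfl | hpos
    · right; left; rw [zero_add, Qp_two h, innerPt]
    · left
      rw [Qp_mid h (by omega) (by omega)]
      rcases YBWalk.index_cases (γ := ω.2) (2 * ω.2.firstHit + (k + 2)) (by omega) with h0 | ⟨i, hi, e⟩ | ⟨i, hi, e⟩ | h0
      · omega
      · refine ⟨i, by omega, hi, Or.inl ?_⟩; rw [e, YBWalk.vtx_odd hi, YBWalk.ptIn]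
      · refine ⟨i, by omega, hi, Or.inr ?_⟩; rw [e, YBWalk.vtx_even hi, YBWalk.ptOut]
      · omega
  · rcases hge.lt_or_eq with hgt | heq
    · have : k = 2 * ω.Mv := by omega
      subst this
      right; left; rw [pJpt_top h, Qp_two h, innerPt]
    · right; right; rw [← heq, pJpt_c₂ h, innerPt]

/-- **The rungs of the prefix are seen under acute angles from the vertices of `J`.** [folklore] -/
theorem sdot_rungP (h : ω.IsB2a) {i : ℕ} (hi : i < ω.2.firstHit) {k : ℕ} (hk : k ≤ 2 * ω.Mv) :
    0 < sdot (midPt (ω.2.nth i)) (midPt (ω.2.nth (i + 1))) (ω.pJpt hr h k) := by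
  have hfM := fh_add_Mv (ω := ω) h
  have hi' : i < ω.2.arcs.length := by omega
  obtain ⟨hs, ht, hst⟩ := YBWalk.side_sIn (γ := ω.2) hi'
  rw [← ω.2.nth_eq_getElem] at hs
  rw [← ω.2.nth_eq_getElem] at ht
  rw [← hs, ← ht, midPt_side, midPt_side]
  have hfc : ω.2.fc i ≠ r := by
    intro e
    have := (YBWalk.arcFace_arcAt hi').1
    rw [YBWalk.arcAt_eq hi', e, ← ω.2.nth_eq_getElem, ← ω.2.nth_eq_getElem] at this
    exact ω.2.arcFace_ne_of_lt_firstHit hi hi' this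
  have hoff : ∀ s : Side, 0 ≤ s.offset.1 ∧ s.offset.1 ≤ 4 ∧ 0 ≤ s.offset.2 ∧ s.offset.2 ≤ 4 := by
    intro s; cases s <;> simp [Side.offset]
  -- the generic step: a vertex `innerPt g σ` with the same-face exclusions
  have step : ∀ (g : Face) (σ : Side),
      (g = ω.2.fc i → σ ≠ ω.2.sIn i ∧ σ ≠ ω.2.sOut i ∧ arcKind (ω.2.sIn i) (ω.2.sOut i) ≠ .straight) →
      0 < sdot ((ω.2.fc i).base + (ω.2.sIn i).offset) ((ω.2.fc i).base + (ω.2.sOut i).offset) (innerPt g σ) := by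
    intro g σ hsame
    refine sdot_pos_split (ω.2.fc i) g (hoff _) (hoff _) σ.inOff_mem fun d hd hg => ?_
    refine table_rung_inner _ _ hst d hd σ ?_
    by_cases hd0 : d = (0, 0)
    · right; exact hsame (by rw [hg, hd0]; simp)
    · left; exact hd0
  rcases ω.pJpt_cases' h hk with ⟨i', hi'1, hi'2, e | e⟩ | e | e
  · rw [e]
    refine step _ _ fun hg => ?_
    obtain ⟨hopp, d1, d2, -, -⟩ := YBWalk.not_straight_of_two_arcs hi' hi'2 (by omega) hg
    exact ⟨d1, d2, arcKind_ne_straight hopp⟩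
  · rw [e]
    refine step _ _ fun hg => ?_
    obtain ⟨hopp, -, -, d3, d4⟩ := YBWalk.not_straight_of_two_arcs hi' hi'2 (by omega) hg
    exact ⟨d3, d4, arcKind_ne_straight hopp⟩
  · rw [e]; exact step _ _ fun hg => absurd hg.symm hfc
  · rw [e]; exact step _ _ fun hg => absurd hg.symm hfc

/-- The vertices of `J` have abscissa `≥ 1`. [folklore] -/
theorem one_le_pJpt_fst (h : ω.IsB2a) {k : ℕ} (hk : k ≤ 2 * ω.Mv) : 1 ≤ (ω.pJpt hr h k).1 := by
  have hin : ∀ (g : Face) (σ : Side), 0 ≤ g.1 → 1 ≤ (innerPt g σ).1 := by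
    intro g σ hg
    have := σ.inOff_mem
    have h1 : 1 ≤ σ.inOff.1 := by cases σ <;> simp [Side.inOff, Side.offset, Side.nIn]
    simp only [innerPt, Face.base, Prod.fst_add]; omega
  rcases ω.pJpt_cases' h hk with ⟨i', -, hi'2, e | e⟩ | e | e
  · rw [e]; exact hin _ _ (YBWalk.fc_mem hi'2).1
  · rw [e]; exact hin _ _ (YBWalk.fc_mem hi'2).1
  · rw [e]; exact hin _ _ hr.1
  · rw [e]; exact hin _ _ hr.1

/-- **`J` does not wind around the starting point of the walk** (it lies in the half-plane
`x ≥ 1`). [folklore] -/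
theorem AJ_origin (h : ω.IsB2a) : ω.AJ hr h (toC (midPt origin)) = 0 := by
  have hM := three_le_Mv hr h
  have e0 : midPt origin = (0, 2) := by simp [origin, midPt]
  refine sweep_eq_zero_of_halfPlane Complex.I_ne_zero _ _ _ (ω.pJ_closed h) (fun k hk => ?_) (fun k hk => ?_) (fun k hk => ?_)
  · rw [pJ_eq_toC]
    intro hh
    have := congrArg Prod.fst (toC_injective hh)
    have h1 := ω.one_le_pJpt_fst (hr := hr) h hk
    rw [this, e0] at h1; simp at h1
  · rw [pJ_eq_toC, ← toC_sub, Complex.mul_im, Complex.I_re, Complex.I_im, zero_mul, one_mul, zero_add, toC_re, Prod.fst_sub, e0]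
    have h1 := ω.one_le_pJpt_fst (hr := hr) h hk
    push_cast
    have : (1 : ℝ) ≤ ((ω.pJpt hr h k).1 : ℝ) := by exact_mod_cast h1
    linarith
  · rw [pJ_eq_toC, pJ_eq_toC, re_seg, ← ω.2.nth_zero]
    exact_mod_cast ω.sdot_pJpt_midPt h (Nat.zero_le _) hk

/-- **Transport of the winding angle of `J` along the prefix.** [folklore] -/
theorem AJ_prefix_step (h : ω.IsB2a) {i : ℕ} (hi : i < ω.2.firstHit) :
    ω.AJ hr h (toC (midPt (ω.2.nth i))) = ω.AJ hr h (toC (midPt (ω.2.nth (i + 1)))) := by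
  refine sweep_eq_sweep_of_closed _ _ _ _ (ω.pJ_closed h) (fun k hk => ?_) (fun k hk => ?_) (fun k hk => ?_)
  · rw [pJ_eq_toC, pJ_eq_toC, re_seg]; exact_mod_cast ω.sdot_pJpt_midPt h hi.le hk
  · rw [pJ_eq_toC, pJ_eq_toC, re_seg]; exact_mod_cast ω.sdot_pJpt_midPt h (by omega) hk
  · rw [pJ_eq_toC, re_seg]; exact_mod_cast ω.sdot_rungP h hi hk

/-- **`J` does not wind around `m₀`.** [folklore] -/
theorem AJ_m₀ (h : ω.IsB2a) : ω.AJ hr h (ω.qQ hr h 0) = 0 := by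
  have key : ∀ i ≤ ω.2.firstHit, ω.AJ hr h (toC (midPt (ω.2.nth i))) = 0 := by
    intro i hi
    induction i with
    | zero => rw [ω.2.nth_zero]; exact ω.AJ_origin h
    | succ i ih => rw [← ω.AJ_prefix_step h (by omega)]; exact ih (by omega)
  have := key _ le_rfl
  rwa [ω.2.nth_firstHit, midPt_side, ← Qp_zero h] at this

/-- The offset of `w` is a tail offset, of corner type. [folklore] -/
theorem wOff_mem (z₀ z₁ z₂ : Side) : wOff z₀ z₁ z₂ ∈ tailOffs z₀ z₁ z₂ := by
  cases z₀ <;> cases z₁ <;> cases z₂ <;> decide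

/-- The open path ends at `w`. [folklore] -/
theorem qQ_w (h : ω.IsB2a) : ω.qQ hr h (ω.mQ hr h + 1) = toC (r.base + wOff ω.2.firstSide (ω.z1 hr h) ω.1) := by
  rw [qQ, mQ, show 2 * ω.Mv + ω.τ hr h + 1 = 2 * ω.Mv + 2 + (ω.τ hr h - 1) by have := τ_pos (ω := ω) (hr := hr) h; omega,
    Qp_tail h, tailPt, wOff, τ]

/-- **The segments of `J` are seen under acute angles from `w`.** [folklore] -/
theorem sdot_pJpt_w (h : ω.IsB2a) (hc : Canon ω.2.firstSide (ω.z1 hr h) ω.1) {k : ℕ} (hk : k < 2 * ω.Mv) :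
    0 < sdot (ω.pJpt hr h k) (ω.pJpt hr h (k + 1)) (r.base + wOff ω.2.firstSide (ω.z1 hr h) ω.1) := by
  have hM := three_le_Mv hr h
  have hfM := fh_add_Mv (ω := ω) h
  have hwm := tailOffs_mem _ _ _ _ (wOff_mem ω.2.firstSide (ω.z1 hr h) ω.1)
  have hct := base_add_cornerType r hwm
  rcases Nat.lt_or_ge k (2 * ω.Mv - 2) with hlt | hge
  · rw [pJpt_lt h hlt.le, pJpt_lt h (by omega), Qp_mid h (by omega) (by omega), Qp_mid h (by omega) (by omega),
      show 2 * ω.2.firstHit + (k + 1 + 2) = 2 * ω.2.firstHit + (k + 2) + 1 by ring]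
    rcases Nat.even_or_odd k with ⟨t, ht⟩ | ⟨t, ht⟩
    · set j := ω.2.firstHit + t with hj_def
      have hK : 2 * ω.2.firstHit + (k + 2) = 2 * j + 2 := by omega
      have hj : j < ω.2.arcs.length := by omega
      have hj1 : j + 1 < ω.2.arcs.length := by omega
      rw [hK]
      have eν : (ω.2.sIn (j + 1)).nIn = -(ω.2.sOut j).nIn :=
        nIn_eq_neg_of_side_eq (((YBWalk.side_sIn hj).2.1).trans ((YBWalk.side_sIn hj1).1).symm) (YBWalk.fc_succ_ne hj1)
      have ek : ω.2.vtx (2 * j + 2) = midPt (ω.2.mids[j + 1]'(YBWalk.lt_length_of_lt_arcs hj)) - (ω.2.sIn (j + 1)).nIn := by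
        rw [YBWalk.vtx_even hj, YBWalk.ptOut, innerPt_eq, (YBWalk.side_sIn hj).2.1, eν, sub_neg_eq_add]
      have ek1 : ω.2.vtx (2 * j + 2 + 1) = midPt (ω.2.mids[j + 1]'(YBWalk.lt_length_of_lt_arcs hj)) + (ω.2.sIn (j + 1)).nIn := by
        rw [show 2 * j + 2 + 1 = 2 * (j + 1) + 1 by ring, YBWalk.vtx_odd hj1, YBWalk.ptIn, innerPt_eq, (YBWalk.side_sIn hj1).1]
      rw [ek, ek1, sdot_cross_eq, Side.nIn_sq]
      have := two_le_dist_cornerType_midPt hct (ω.2.mids[j + 1]'(YBWalk.lt_length_of_lt_arcs hj))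
      omega
    · set j := ω.2.firstHit + t + 1 with hj_def
      have hK : 2 * ω.2.firstHit + (k + 2) = 2 * j + 1 := by omega
      have hj : j < ω.2.arcs.length := by omega
      rw [hK, YBWalk.vtx_odd hj, show 2 * j + 1 + 1 = 2 * j + 2 by ring, YBWalk.vtx_even hj, YBWalk.ptIn, YBWalk.ptOut,
        innerPt, innerPt]
      have hne : ω.2.fc j ≠ r := ω.fc_ne hr h (by omega) hj
      refine sdot_pos_split' r (ω.2.fc j) (ω.2.sIn j).inOff_mem (ω.2.sOut j).inOff_mem (by omega) fun d hd hg => ?_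
      have hd0 : d ≠ (0, 0) := by rintro rfl; apply hne; rw [hg]; simp
      refine table_corner_chord _ ?_ d hd hd0 _ _ (YBWalk.side_sIn hj).2.2
      generalize wOff ω.snd.firstSide (ω.z1 hr h) ω.fst = p at hwm ⊢
      obtain ⟨u, v⟩ := p
      simp only at hwm
      rcases hwm with ⟨rfl | rfl, rfl | rfl⟩ <;> simp
  · rcases Nat.lt_or_ge k (2 * ω.Mv - 1) with hlt' | hge'
    · have hk' : k = 2 * ω.Mv - 2 := by omega
      subst hk'
      rw [pJpt_lt h le_rfl, show 2 * ω.Mv - 2 + 2 = 2 * ω.Mv by omega, Qp_qlast h,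
        show 2 * ω.Mv - 2 + 1 = 2 * ω.Mv - 1 by omega, pJpt_c₂ h, Side.inOff, ← add_assoc, ← midPt_side, add_sub_assoc', ← midPt_side]
      rw [sdot_cross_eq, Side.nIn_sq]
      have := two_le_dist_cornerType_midPt hct (r.side ω.1)
      omega
    · have hk' : k = 2 * ω.Mv - 1 := by omega
      subst hk'
      rw [pJpt_c₂ h, show 2 * ω.Mv - 1 + 1 = 2 * ω.Mv by omega, pJpt_top h, Qp_two h, add_comm r.base, add_comm r.base,
        add_comm r.base, sdot_add]
      exact (table_local _ _ _ hc).2.2.2.2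

/-- **The rung `[m₀, w]` is seen under acute angles from the vertices of `J`.** [folklore] -/
theorem sdot_rung_w (h : ω.IsB2a) (hc : Canon ω.2.firstSide (ω.z1 hr h) ω.1) {k : ℕ} (hk : k ≤ 2 * ω.Mv) :
    0 < sdot (r.base + ω.2.firstSide.offset) (r.base + wOff ω.2.firstSide (ω.z1 hr h) ω.1) (ω.pJpt hr h k) := by
  have hoff : ∀ s : Side, 0 ≤ s.offset.1 ∧ s.offset.1 ≤ 4 ∧ 0 ≤ s.offset.2 ∧ s.offset.2 ≤ 4 := by
    intro s; cases s <;> simp [Side.offset]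
  have hwm := tailOffs_mem _ _ _ _ (wOff_mem ω.2.firstSide (ω.z1 hr h) ω.1)
  have hw4 : 0 ≤ (wOff ω.2.firstSide (ω.z1 hr h) ω.1).1 ∧ (wOff ω.2.firstSide (ω.z1 hr h) ω.1).1 ≤ 4 ∧
      0 ≤ (wOff ω.2.firstSide (ω.z1 hr h) ω.1).2 ∧ (wOff ω.2.firstSide (ω.z1 hr h) ω.1).2 ≤ 4 := by omega
  have step : ∀ (g : Face) (σ : Side), (g = r → σ = ω.z1 hr h ∨ σ = ω.1) →
      0 < sdot (r.base + ω.2.firstSide.offset) (r.base + wOff ω.2.firstSide (ω.z1 hr h) ω.1) (innerPt g σ) := by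
    intro g σ hsame
    refine sdot_pos_split r g (hoff _) hw4 σ.inOff_mem fun d hd hg => ?_
    refine table_rung_w _ _ _ hc d hd σ ?_
    by_cases hd0 : d = (0, 0)
    · right; exact hsame (by rw [hg, hd0]; simp)
    · left; exact hd0
  rcases ω.pJpt_cases' h hk with ⟨i', hi'1, hi'2, e | e⟩ | e | e
  · rw [e]; exact step _ _ fun hg => absurd hg (ω.fc_ne hr h hi'1 hi'2)
  · rw [e]; exact step _ _ fun hg => absurd hg (ω.fc_ne hr h hi'1 hi'2)
  · rw [e]; exact step _ _ fun _ => Or.inl rfl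
  · rw [e]; exact step _ _ fun _ => Or.inr rfl

/-- **`J` does not wind around `w`.** [folklore] -/
theorem AJ_w (h : ω.IsB2a) (hc : Canon ω.2.firstSide (ω.z1 hr h) ω.1) : ω.AJ hr h (ω.qQ hr h (ω.mQ hr h + 1)) = 0 := by
  rw [← ω.AJ_m₀ h, qQ_w h, eq_comm, qQ, Qp_zero h]
  refine sweep_eq_sweep_of_closed _ _ _ _ (ω.pJ_closed h) (fun k hk => ?_) (fun k hk => ?_) (fun k hk => ?_)
  · rw [pJ_eq_toC, pJ_eq_toC, re_seg, ← midPt_side, ← ω.2.nth_firstHit]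
    exact_mod_cast ω.sdot_pJpt_midPt h le_rfl hk
  · rw [pJ_eq_toC, pJ_eq_toC, re_seg]; exact_mod_cast ω.sdot_pJpt_w h hc hk
  · rw [pJ_eq_toC, re_seg]; exact_mod_cast ω.sdot_rung_w h hc hk

/-! #### Assembly: the right-angle winding of the excursion is the local constant -/

/-- The vertices of the open path from one unit outside the return side on. [folklore] -/
theorem qQ_X (h : ω.IsB2a) {i : ℕ} (hi : i ≤ ω.τ hr h + 1) :
    ω.qQ hr h (2 * ω.Mv + i) = toC (r.base + Xo ω.2.firstSide (ω.z1 hr h) ω.1 i) := by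
  rcases Nat.eq_zero_or_pos i with rfl | hpos
  · rw [add_zero, qQ, Qp_qlast h, Xo, if_pos rfl]
  · obtain ⟨i', rfl⟩ : ∃ i', i = i' + 1 := ⟨i - 1, by omega⟩
    rw [qQ, show 2 * ω.Mv + (i' + 1) = 2 * ω.Mv + 1 + i' by ring, Qp_tailPts h (by omega), Xo, if_neg (by omega),
      Nat.add_sub_cancel]

/-- **The right-angle winding of a canonical excursion is the local constant `Loc`.** [folklore] -/
theorem WE_pi_div_two_eq_Loc (h : ω.IsB2a) (hc : Canon ω.2.firstSide (ω.z1 hr h) ω.1) :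
    ω.WE (fun _ => π / 2) = Loc ω.2.firstSide (ω.z1 hr h) ω.1 := by
  have hM := three_le_Mv hr h
  have key := ω.hopfQ h hc
  rw [ω.T_eq h, ω.S₂_eq h, ω.S₁_eq h hc, ω.AJ_m₀ h, ω.AJ_w h hc, zero_add, zero_add] at key
  -- identify the points
  have e0 : ω.qQ hr h 0 = toC (r.base + ω.2.firstSide.offset) := by rw [qQ, Qp_zero h]
  have e1 : ω.qQ hr h 1 = toC (r.base + ω.2.firstSide.inOff) := by rw [qQ, Qp_one h]
  have e2 : ω.qQ hr h 2 = toC (r.base + (ω.z1 hr h).inOff) := by rw [qQ, Qp_two h]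
  have eq : ω.qQ hr h (2 * ω.Mv) = toC (r.base + Xo ω.2.firstSide (ω.z1 hr h) ω.1 0) := by
    have := ω.qQ_X (hr := hr) h (i := 0) (by omega); rwa [add_zero] at this
  have ew := ω.qQ_w (hr := hr) h
  have hL₂ : (angAt (ω.qQ hr h 0) (ω.qQ hr h 1) (ω.qQ hr h 2) -
      angAt (ω.qQ hr h 0) (ω.qQ hr h (2 * ω.Mv)) (toC (r.base + ω.1.inOff)) -
      angAt (ω.qQ hr h 0) (toC (r.base + ω.1.inOff)) (ω.qQ hr h 2) +
      ∑ i ∈ Finset.range (ω.τ hr h + 1), angAt (ω.qQ hr h 0) (ω.qQ hr h (2 * ω.Mv + i)) (ω.qQ hr h (2 * ω.Mv + 1 + i))) =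
      L₂off ω.2.firstSide (ω.z1 hr h) ω.1 := by
    rw [L₂off, e0, e1, e2, eq, angAt_transl, angAt_transl, angAt_transl, τ]
    congr 1
    refine Finset.sum_congr rfl fun i hi => ?_
    rw [Finset.mem_range] at hi
    rw [ω.qQ_X h (by unfold τ; omega), show 2 * ω.Mv + 1 + i = 2 * ω.Mv + (i + 1) by ring, ω.qQ_X h (by unfold τ; omega),
      angAt_transl]
  have hL₁ : (angAt (ω.qQ hr h (ω.mQ hr h + 1)) (ω.qQ hr h 0) (ω.qQ hr h 1) +
      angAt (ω.qQ hr h (ω.mQ hr h + 1)) (ω.qQ hr h 1) (ω.qQ hr h 2) -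
      angAt (ω.qQ hr h (ω.mQ hr h + 1)) (ω.qQ hr h (2 * ω.Mv)) (toC (r.base + ω.1.inOff)) -
      angAt (ω.qQ hr h (ω.mQ hr h + 1)) (toC (r.base + ω.1.inOff)) (ω.qQ hr h 2) +
      ∑ i ∈ Finset.range (ω.τ hr h), angAt (ω.qQ hr h (ω.mQ hr h + 1)) (ω.qQ hr h (2 * ω.Mv + i)) (ω.qQ hr h (2 * ω.Mv + 1 + i))) =
      L₁off ω.2.firstSide (ω.z1 hr h) ω.1 := by
    rw [L₁off, ew, e0, e1, e2, eq, angAt_transl, angAt_transl, angAt_transl, angAt_transl, τ]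
    congr 1
    refine Finset.sum_congr rfl fun i hi => ?_
    rw [Finset.mem_range] at hi
    rw [ω.qQ_X h (by unfold τ; omega), show 2 * ω.Mv + 1 + i = 2 * ω.Mv + (i + 1) by ring, ω.qQ_X h (by unfold τ; omega),
      angAt_transl]
  have hT : ∑ i ∈ Finset.range (ω.τ hr h), ω.extQ hr h (2 * ω.Mv + i) = tailExtOff ω.2.firstSide (ω.z1 hr h) ω.1 := by
    rw [tailExtOff, τ]
    refine Finset.sum_congr rfl fun i hi => ?_
    rw [Finset.mem_range] at hi
    unfold extQ
    rw [show 2 * ω.Mv + i + 2 = 2 * ω.Mv + (i + 2) by ring, show 2 * ω.Mv + i + 1 = 2 * ω.Mv + (i + 1) by ring,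
      ω.qQ_X h (by unfold τ; omega), ω.qQ_X h (by unfold τ; omega), ω.qQ_X h (by unfold τ; omega), ← toC_sub, ← toC_sub,
      add_sub_add_left_eq_sub, add_sub_add_left_eq_sub]
  rw [hL₂, hL₁, hT] at key
  rw [Loc]
  linarith

end Path

end Ω

/-! ### The excursion winding: reduction to right angles and to the canonical orientation -/

/-- The tabulated excursion windings at a general angle from those at right angles. [folklore] -/
theorem excursionWinding_theta (θ : ℝ) {z₀ z₁ z₂ : Side} (h01 : z₀ ≠ z₁) (h02 : z₀ ≠ z₂) (h12 : z₁ ≠ z₂) :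
    excursionWinding θ z₀ z₁ z₂ = excursionWinding (π / 2) z₀ z₁ z₂ + (θ - π / 2) * (z₂.slantInd - z₁.slantInd) := by
  revert h01 h02 h12
  cases z₀ <;> cases z₁ <;> cases z₂ <;> simp [excursionWinding, Side.slantInd]

namespace YBWalk

variable {D : Set Face} {a z : MidEdge}

/-- **The suffix of a walk from the index `k`.** [folklore] -/
def drop (γ : YBWalk D a z) (k : ℕ) (hk : k ≤ γ.arcs.length) : YBWalk D (γ.nth k) z :=
  (ofFn (γ.arcs.length - k) (fun i => γ.nth (k + i))
    (fun i j hi hj h => by have := γ.nth_inj (by omega) (by omega) h; omega)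
    (fun i hi => by rw [show k + (i + 1) = k + i + 1 by ring]; exact γ.arc_nth (by omega))
    (fun i hi => by
      rw [show k + (i + 1) = k + i + 1 by ring, show k + (i + 2) = k + i + 2 by ring]; exact γ.chain_nth (by omega))
    (fun i j hi hj f hWE => by
      rw [show k + (j + 1) = k + j + 1 by ring]; rw [show k + (i + 1) = k + i + 1 by ring] at hWE
      exact γ.nc_nth (by omega) (by omega) f hWE)).cast (by rw [add_zero])
    (by rw [show k + (γ.arcs.length - k) = γ.arcs.length by omega, nth_length])

/-- The arcs of a suffix. [folklore] -/
theorem drop_arcs (γ : YBWalk D a z) (k : ℕ) (hk : k ≤ γ.arcs.length) : (γ.drop k hk).arcs = γ.arcs.drop k := by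
  have hl : (γ.drop k hk).arcs.length = γ.arcs.length - k := by
    rw [length_arcs, drop, cast_mids, ofFn_mids, List.length_ofFn]; omega
  have hn : ∀ i ≤ γ.arcs.length - k, (γ.drop k hk).nth i = γ.nth (k + i) := by
    intro i hi
    rw [nth_eq_getElem _ (by rw [drop, cast_mids, ofFn_mids, List.length_ofFn]; omega)]
    simp [drop, ofFn_mids, -List.ofFn_succ]
  apply List.ext_getElem
  · rw [hl, List.length_drop]
  · intro i h1 h2
    rw [arcs_getElem_eq_nth _ h1, List.getElem_drop, arcs_getElem_eq_nth _ (by rw [hl] at h1; omega),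
      hn _ (by rw [hl] at h1; omega), hn _ (by rw [hl] at h1; omega), show k + (i + 1) = k + i + 1 by ring]

end YBWalk

namespace Ω

variable {T L : ℕ} {r : Face} (ω : Ω T L r)

/-- **The winding of the excursion at general angles**: the right-angle winding plus the
potential difference of the return and exit sides. [folklore] -/
theorem WE_eq_WE_pi_div_two_add (hr : r ∈ rect T L) (h : ω.IsB2a) (Θ : ℤ → ℝ) :
    ω.WE Θ = ω.WE (fun _ => π / 2) + (Θ r.1 - π / 2) * ((ω.1).slantInd - (ω.2.exitSide hr (ω.fh_lt h)).slantInd) := by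
  have hfh := ω.fh_lt h
  set X := ω.2.drop (ω.2.firstHit + 1) (by omega) with hX
  have hXa : X.arcs = ω.2.arcs.drop (ω.2.firstHit + 1) := YBWalk.drop_arcs _ _ _
  have hW : ∀ Θ' : ℤ → ℝ, ω.WE Θ' = X.winding Θ' := by
    intro Θ'; rw [WE, YBWalk.winding, hXa]
  have e1 : slantPot Θ (ω.2.nth (ω.2.firstHit + 1)) = slantPot Θ (r.side (ω.2.exitSide hr hfh)) := by
    rw [(ω.2.exitSide_spec hr hfh).1]
  rw [hW, hW, YBWalk.winding_eq_winding_pi_div_two_add Θ X, e1, slantPot_side, slantPot_side]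
  ring

/-- **The excursion winding of a walk of class `B2a`** (all orientations, all angles). [folklore] -/
theorem WE_eq_excursionWinding (hr : r ∈ rect T L) (h : ω.IsB2a) (Θ : ℤ → ℝ) :
    ω.WE Θ = excursionWinding (Θ r.1) ω.2.firstSide (ω.2.exitSide hr (ω.fh_lt h)) ω.1 := by
  -- first at right angles, in both orientations
  have key : ∀ ω' : Ω T L r, ∀ h' : ω'.IsB2a,
      ω'.WE (fun _ => π / 2) = excursionWinding (π / 2) ω'.2.firstSide (ω'.2.exitSide hr (ω'.fh_lt h')) ω'.1 := by
    intro ω' h'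
    have hd := ω'.2.sides_distinct hr h'.1
    rw [ω'.returnSide_of_isB2a h'] at hd
    rcases canon_or_swap hd.1.symm hd.2.1.symm hd.2.2.symm with hc | hc
    · rw [ω'.WE_pi_div_two_eq_Loc h' hc]; unfold Ω.z1; rw [Loc_eq hc]
    · -- the reversed walk is canonical
      have h'' := ω'.rev_isB2a hr h'
      have hc' : Canon (ω'.rev hr).2.firstSide ((ω'.rev hr).z1 hr h'') (ω'.rev hr).1 := by
        unfold Ω.z1; rw [ω'.rev_firstSide hr h', ω'.rev_exitSide hr h', ω'.rev_fst hr h']; exact hc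
      have e := (ω'.rev hr).WE_pi_div_two_eq_Loc h'' hc'
      unfold Ω.z1 at e
      rw [ω'.rev_WE (fun _ => π / 2) hr h', ω'.rev_firstSide hr h', ω'.rev_exitSide hr h', ω'.rev_fst hr h',
        Loc_eq hc, excursionWinding_swap] at e
      linarith
  have hd := ω.2.sides_distinct hr h.1
  rw [ω.returnSide_of_isB2a h] at hd
  rw [ω.WE_eq_WE_pi_div_two_add hr h Θ, key ω h,
    excursionWinding_theta (Θ r.1) hd.1.symm hd.2.1.symm hd.2.2.symm]

end Ω

/-- **The excursion windings** (discharge of `GlazmanManolescu2019_excursionWinding`): the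
excursion of a self-avoiding walk of `Rect_{T,L}` outside a rhombus `r`, from its exit side `z₁`
to its return side `z₂` after the first crossing at `z₀`, winds by `excursionWinding θ_r z₀ z₁ z₂`.
Proof: reduction to right angles (`Ω.WE_eq_WE_pi_div_two_add`) and to the twelve canonical
orientations (`Ω.rev`); Hopf's identity for the open lattice polyline `m₀ → c₀ → c₁ → (excursion) →
E → tail` (`Ω.hopfQ`, hypothesis `Ω.subtQ`); the two swept angles are the winding angles of the
closed polygon `J` (the excursion closed through `r`) around `m₀` and around the far base point
`w`, plus local terms (`Ω.S₂_eq`, `Ω.S₁_eq`); `J` does not wind around `m₀` — transport of the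
winding angle from the starting point of the walk along the prefix (`Ω.AJ_m₀`) — nor around `w`
(`Ω.AJ_w`); the local terms are evaluated exactly (`Loc_eq`).
[cite: GlazmanManolescu2019, Lemma 2.1 (proof); Glazman2015WeightedSAW, Lemma 3.1 (proof)] -/
theorem GlazmanManolescu2019_excursionWinding_holds : GlazmanManolescu2019_excursionWinding :=
  fun _ _ Θ _ _ hr ω h => ω.WE_eq_excursionWinding hr h Θ


/-! ### Lemma 2.1, Lemma 2.2 and Corollary 2.3 -/

/-- **Lemma 2.1 (the vertex relation (CR))**, discharged: the grouping argument
(`GlazmanManolescu2019_lem21_of_excursionWinding`) and the excursion windings.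
[cite: GlazmanManolescu2019, Lemma 2.1] -/
theorem GlazmanManolescu2019_lem21_holds : GlazmanManolescu2019_lem21 :=
  GlazmanManolescu2019_lem21_of_excursionWinding GlazmanManolescu2019_excursionWinding_holds

/-- **Lemma 2.2** (`1 = cos(3π/8) A + B + D + E`), discharged. [cite: GlazmanManolescu2019, Lemma 2.2] -/
theorem GlazmanManolescu2019_lem22_holds : GlazmanManolescu2019_lem22 :=
  GlazmanManolescu2019_lem22_of GlazmanManolescu2019_lem21_holds GlazmanManolescu2019_boundaryWinding_holds

/-- **Corollary 2.3** (`cos(3π/8) A_{T,Θ} + B_{T,Θ} = 1` for every `T ≥ 1` and every `Θ` with angles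
in `[π/3, 2π/3]`), discharged. [cite: GlazmanManolescu2019, Corollary 2.3] -/
theorem GlazmanManolescu2019_cor23_holds : GlazmanManolescu2019_cor23 :=
  GlazmanManolescu2019_cor23_of GlazmanManolescu2019_lem22_holds GlazmanManolescu2019_boundaryWinding_holds

/-- **Theorem 1 from Propositions 1.1 and 4.2** (the remaining named facts).
[cite: GlazmanManolescu2019, Theorem 1 (proof, §4)] -/
theorem GlazmanManolescu2019_thm1_of_prop11_prop42 (h11 : GlazmanManolescu2019_prop11_limit)
    (h42 : GlazmanManolescu2019_prop42) : GlazmanManolescu2019_thm1 :=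
  GlazmanManolescu2019_thm1_of_lem21 GlazmanManolescu2019_lem21_holds GlazmanManolescu2019_boundaryWinding_holds h11 h42

/-- **Theorem 2 from Propositions 1.1 and 4.2.** [cite: GlazmanManolescu2019, Theorem 2 (proof, §4)] -/
theorem GlazmanManolescu2019_thm2_of_prop11_prop42 (h11 : GlazmanManolescu2019_prop11_limit)
    (h42 : GlazmanManolescu2019_prop42) : GlazmanManolescu2019_thm2 :=
  GlazmanManolescu2019_thm2_of_lem21 GlazmanManolescu2019_lem21_holds GlazmanManolescu2019_boundaryWinding_holds h11 h42

end Literature.Probability.RandomPlanarGeometry.SAW.YangBaxter
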